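import Literature.Probability.RandomPlanarGeometry.SkorokhodTimeControl
import Literature.Probability.Process.PathSpaceModulus
import HarnessLib
import Literature.Probability.RandomPlanarGeometry.USTPeanoSetting
import Literature.Probability.RandomPlanarGeometry.LSW2004UST

/-!
# The driving-function convergence engine of Lawler–Schramm–Werner (2004), §3.3

Topic `Probability/RandomPlanarGeometry`, sub-namespace `SkorokhodEmbedding`. Everything here is
PROVED; no named fact is introduced.

Lawler–Schramm–Werner (2004) prove the convergence of the Loewner driving function of
loop-erased random walk (Thm. 3.7, `κ = 2`) and of the UST Peano curve (Thm. 4.4, `κ = 8`: "The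
proof is almost identical to the proof of Theorem 3.7, where we used Skorokhod's embedding", arXiv
version p. 23) by one argument (§3.3; arXiv version math/0112234, pp. 14–15): given the **key
estimate** on the discrete side — along the stopping indices `m_n`
(first time the driving value moves by `δ` or the capacity by `δ²`),
`E[Δ_{m_{n+1}} - Δ_{m_n} | 𝓕_n] = O(δ³)` and
`E[(Δ_{m_{n+1}} - Δ_{m_n})² | 𝓕_n] = κ E[t_{m_{n+1}} - t_{m_n} | 𝓕_n] + O(δ³)` — one compensates
the driving increments into a martingale `M_n` with `‖M_{n+1} - M_n‖_∞ ≤ 2δ`, Skorokhod-embeds it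
into a Brownian motion `B` (`B_{τ_n} = M_n`, Lemma 3.8), shows by two applications of Doob's
maximal inequality that `Y_n := ∑_{j<n} (M_{j+1} - M_j)²` stays close to `κ t_{m_n}` and `τ_n`
stays close to `Y_n`, hence `τ_n ≈ κ t_{m_n}`, and concludes with the a.s. continuity of `B` that
the driving function `W` satisfies `sup_{t ≤ T} |W(t) - B(κ t)| → 0` in probability.

This file is that argument as an abstract theorem. The input is `DrivingData`: martingale data
`(P, H, M, δ)` on a finite probability space together with adapted capacities `tcap k`
(`= t_{m_k}`), driving values `dval k` (`= Δ_{m_k} = W(t_{m_k})`), the sample driving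
function `drv : Ω → C([0,∞), ℝ)`, the diffusivity `κ` and the constants of the key estimate;
`DrivingData.IsValid N` lists the hypotheses actually used in §3.3 (arXiv pp. 14–15; increments of `tcap`
at most `2δ²`, of `dval` at most `2δ`, `|ΔM - ΔΔ| ≤ C₁ δ³`, the atomwise key estimate with
constant `C₂`, and the `2δ`-oscillation of `drv` between consecutive `tcap`'s; the defining lower
bound `(ΔΔ)² + Δt ≥ δ²` of the stopping indices enters only through the probability of the event
`lowerFailSet` where it fails, so that data frozen after a stopping index are allowed). The output, for a Skorokhod embedding
witness `E` (file `SkorokhodTimeControl`), is the bound `measure_sup_drv_sub_B_ge_le`: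

`Q{∃ s ≤ T, ε ≤ |drv(X)(s) - B(κ s)|} ≤ N (4+2κ)² δ⁴ / λ² + N (512 C₄ + 32) δ⁴ / λ²
  + μ_W (badModulusSet (κT + η) η (ε/2)) + P(lowerFailSet N)`,

with `η = 2λ + N (C₂ δ³ + 4 C₁ δ⁴) + 2κδ²`, valid when `2δ + C₁ δ³ N ≤ ε/2` and
`(κ+1) T + λ + N (C₂ δ³ + 4 C₁ δ⁴) ≤ N (δ² - 4 C₁ δ⁴)`; here `μ_W` is the Wiener law on path space
and `badModulusSet` the tree's modulus-of-continuity event, whose `μ_W`-measure tends to `0` with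
`η` (`tendsto_measure_badModulusSet`). With `N ≈ 10 T δ⁻²`, `λ = δ^{1/2}` every term is `o(1)`
as `δ → 0` — this is [LSW04]'s "`O(Tδ)`" bookkeeping, made explicit.

For the proof of Thm. 4.4 (arXiv version p. 23), where Lawler–Schramm–Werner run the argument only
up to `T₀ = min{T, t_k}`, `k` the first index at which the inner radius or the harmonic measure
condition fails ("it may happen that `0` is 'swallowed' before time `T`"), the file also proves
the truncation-friendly forms: `measure_sup_drv_sub_B_ge_trunc_le` (the same bound for the
deviation over `s ≤ min(T, t_{m_N})`, with no `lowerFailSet` term and no horizon condition, so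
that data frozen from a truncation index on are covered), `DrivingData.measure_tcap_le_diff_lowerFailSet_le`
(`t_{m_N} > T` off `lowerFailSet` and the first Doob event), `exists_coupling_trunc_le` (the
coupling on `Ω × C`, keeping the sample as first coordinate) and
`exists_delta_forall_coupling_trunc_lt` (its `o(1)` form).

The later parts of the file package the engine: `exists_coupling_le` / `exists_delta_forall_coupling_lt`
(a coupling `ρ` on `C × C` with the stated marginals and `ρ{sup-deviation} < ε₃ + P(lowerFailSet)`
for `δ ≤ δ₀(ε₂, ε₃, T, κ, C₁, C₂)`), the identification `wienerLawC_map_timeScale_eight` of the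
second marginal for `κ = 8` with the tree's `preWienerMeasure.map brownianTimeEight`, the reduction
`USTPeano.drivingProcess_tendsto_of_drivingData` of the named fact `USTPeano.drivingProcess_tendsto`
([LSW04] Thm. 4.4 as used for Thm. 4.7) to the discrete key estimate, and the constructor
`RawDrivingData.toDrivingData` forming LSW's compensated martingale `M_n` from raw driving data
(`drivingProcess_tendsto_of_rawDrivingData`).

## References

* G. F. Lawler, O. Schramm, W. Werner, *Conformal invariance of planar loop-erased random walks
  and uniform spanning trees*, Ann. Probab. 32 (2004), §3.3 (proof of Thm. 3.7) and Thm. 4.4.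
-/

noncomputable section

open MeasureTheory ProbabilityTheory Filter Set
open scoped NNReal ENNReal Topology

namespace Literature.Probability.RandomPlanarGeometry.SkorokhodEmbedding

open Literature.Probability.Process Literature.Probability.RandomPlanarGeometry

/-! ### Driving data and the hypotheses of the engine -/

/-- **Driving data** for the convergence engine of Lawler–Schramm–Werner (2004), §3.3:
martingale data `(P, H, M, δ)` on a finite probability space (the compensated driving increments
along the stopping indices `m_k`), the capacities `tcap k = t_{m_k}`, the driving values
`dval k = Δ_{m_k} = W(t_{m_k})`, the driving function `drv ω = W` of the sample, the diffusivity
`κ` and the constants `C₁, C₂` of the key estimate. [cite: LawlerSchrammWerner2004, Theorem 3.7] -/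
structure DrivingData (Ω Λ : Type) [MeasurableSpace Ω] extends MartingaleData Ω Λ where
  /-- the capacities `t_{m_k}` -/
  tcap : ℕ → Ω → ℝ≥0
  /-- the driving values `Δ_{m_k} = W(t_{m_k})` -/
  dval : ℕ → Ω → ℝ
  /-- the driving function of the sample -/
  drv : Ω → C(ℝ≥0, ℝ)
  /-- the diffusivity -/
  κ : ℝ
  /-- the constant of `|ΔM - ΔΔ| ≤ C₁ δ³` -/
  C₁ : ℝ
  /-- the constant of the key estimate `|E[(ΔΔ)² - κ Δt | 𝓕]| ≤ C₂ δ³` -/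
  C₂ : ℝ

namespace DrivingData

variable {Ω Λ : Type} [Fintype Ω] [MeasurableSpace Ω] [DecidableEq Λ] (DD : DrivingData Ω Λ)

/-- **The hypotheses of the engine** up to the horizon `N` (Lawler–Schramm–Werner (2004), §3.3,
arXiv version pp. 14–15): valid martingale data; `δ > 0`, `κ, C₁, C₂ ≥ 0`; capacities and driving values adapted,
starting at `0`, capacities nondecreasing with increments `≤ 2δ²` ("our choice of `r₁` ensures
that `t_{j+1} - t_j ≤ 2δ²`"), driving increments `≤ 2δ`; `|ΔM - ΔΔ| ≤ C₁ δ³` (from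
the display `E[Δ_{m_{n+1}} - Δ_{m_n} | 𝓕_n] = O(δ³)` of §3.3); the key estimate
`|E[(ΔΔ)² - κ Δt | 𝓕_k]| ≤ C₂ δ³` atom by atom (the display
`E[(Δ_{m_{n+1}} - Δ_{m_n})² | 𝓕_n] = 2 E[t_{m_{n+1}} - t_{m_n} | 𝓕_n] + O(δ³)`, with `κ` for `2`); and
`W(t_{m_k}) = Δ_{m_k}` with the `2δ`-oscillation of `W` on `[t_{m_k}, t_{m_{k+1}}]` (the display
`sup{|ϑ(t) - Δ_{t_{m_n}}| : t ∈ [t_{m_n}, t_{m_{n+1}}]} ≤ 2δ`).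
[cite: LawlerSchrammWerner2004, Theorem 3.7] -/
structure IsValid (N : ℕ) : Prop where
  md : DD.toMartingaleData.IsValid
  δ_pos : 0 < DD.δ
  κ_nonneg : 0 ≤ DD.κ
  C₁_nonneg : 0 ≤ DD.C₁
  C₂_nonneg : 0 ≤ DD.C₂
  t_adapt : ∀ k ω ω', DD.H k ω = DD.H k ω' → DD.tcap k ω = DD.tcap k ω'
  d_adapt : ∀ k ω ω', DD.H k ω = DD.H k ω' → DD.dval k ω = DD.dval k ω'
  t_zero : ∀ ω, DD.tcap 0 ω = 0
  d_zero : ∀ ω, DD.dval 0 ω = 0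
  t_mono : ∀ k ω, DD.tcap k ω ≤ DD.tcap (k + 1) ω
  t_inc : ∀ k < N, ∀ ω, (DD.tcap (k + 1) ω : ℝ) - DD.tcap k ω ≤ 2 * DD.δ ^ 2
  d_inc : ∀ k < N, ∀ ω, |DD.dval (k + 1) ω - DD.dval k ω| ≤ 2 * DD.δ
  M_sub_d : ∀ k < N, ∀ ω,
    |(DD.M (k + 1) ω - DD.M k ω) - (DD.dval (k + 1) ω - DD.dval k ω)| ≤ DD.C₁ * DD.δ ^ 3
  key : ∀ k < N, ∀ l, |DD.condMean k (fun ω ↦ (DD.dval (k + 1) ω - DD.dval k ω) ^ 2 -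
    DD.κ * ((DD.tcap (k + 1) ω : ℝ) - DD.tcap k ω)) l| ≤ DD.C₂ * DD.δ ^ 3
  drv_at : ∀ k ≤ N, ∀ ω, DD.drv ω (DD.tcap k ω) = DD.dval k ω
  drv_osc : ∀ k < N, ∀ ω, ∀ s : ℝ≥0, DD.tcap k ω ≤ s → s ≤ DD.tcap (k + 1) ω →
    |DD.drv ω s - DD.dval k ω| ≤ 2 * DD.δ

/-- **The quadratic sums** `Y_k = ∑_{j<k} (M_{j+1} - M_j)²`. [cite: LawlerSchrammWerner2004, Theorem 3.7] -/
def Y (k : ℕ) (ω : Ω) : ℝ := ∑ j ∈ Finset.range k, (DD.M (j + 1) ω - DD.M j ω) ^ 2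

/-- **The process `Z_k = Y_k - κ t_{m_k}`**. [cite: LawlerSchrammWerner2004, Theorem 3.7] -/
def Z (k : ℕ) (ω : Ω) : ℝ := DD.Y k ω - DD.κ * (DD.tcap k ω : ℝ)

/-- The drift bound `d = C₂ δ³ + 4 C₁ δ⁴` of `Z`. [folklore] -/
def dZ : ℝ := DD.C₂ * DD.δ ^ 3 + 4 * DD.C₁ * DD.δ ^ 4

/-- The increment bound `b = (4 + 2κ) δ²` of `Z`. [folklore] -/
def bZ : ℝ := (4 + 2 * DD.κ) * DD.δ ^ 2

/-- **The event where the defining lower bound of the stopping indices fails** before the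
horizon: some `k < N` with `(Δ_{m_{k+1}} - Δ_{m_k})² + (t_{m_{k+1}} - t_{m_k}) < δ²`. For the data of
§3.3 ("By the definition of the `t_{m_n}`, we have `Y_{n+1} - Y_n + t_{m_{n+1}} - t_{m_n} ≥ δ²`") it is
empty; it is charged to the error when the data are frozen after a stopping index (proof of
Thm. 4.4, arXiv p. 23: "it may happen that `0` is swallowed before time `T`").
[cite: LawlerSchrammWerner2004, Theorem 3.7] -/
def lowerFailSet (N : ℕ) : Set Ω :=
  {ω | ∃ k < N, (DD.dval (k + 1) ω - DD.dval k ω) ^ 2 + ((DD.tcap (k + 1) ω : ℝ) - DD.tcap k ω) <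
    DD.δ ^ 2}

variable {DD} {N : ℕ}

/-! ### Deterministic consequences -/

/-- **The driving values follow the martingale**: `|Δ_{m_k} - M_k| ≤ C₁ δ³ k` (telescoping
`|ΔM - ΔΔ| ≤ C₁ δ³`; Lawler–Schramm–Werner's display `sup{|Δ_{t_{m_n}} - M_n| : n ≤ N} = O(δ³ N)`).
[cite: LawlerSchrammWerner2004, Theorem 3.7] -/
theorem abs_dval_sub_M_le (hV : DD.IsValid N) {k : ℕ} (hk : k ≤ N) (ω : Ω) :
    |DD.dval k ω - DD.M k ω| ≤ DD.C₁ * DD.δ ^ 3 * k := by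
  induction k with
  | zero => simp [hV.d_zero ω, hV.md.zero ω]
  | succ k ih =>
    have hk' : k < N := Nat.lt_of_succ_le hk
    have h1 := ih hk'.le
    have h2 := hV.M_sub_d k hk' ω
    rw [abs_le] at h1 h2 ⊢
    push_cast
    constructor <;> nlinarith [h1.1, h1.2, h2.1, h2.2]

/-- `(ΔM)²` and `(ΔΔ)²` differ by at most `4 C₁ δ⁴`. [folklore] -/
theorem abs_M_sq_sub_d_sq_le (hV : DD.IsValid N) {k : ℕ} (hk : k < N) (ω : Ω) :
    |(DD.M (k + 1) ω - DD.M k ω) ^ 2 - (DD.dval (k + 1) ω - DD.dval k ω) ^ 2| ≤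
      4 * DD.C₁ * DD.δ ^ 4 := by
  have h1 := hV.M_sub_d k hk ω
  have h2 := hV.d_inc k hk ω
  have h3 := hV.md.bdd k ω
  rw [sq_sub_sq, abs_mul]
  have h4 : |DD.M (k + 1) ω - DD.M k ω + (DD.dval (k + 1) ω - DD.dval k ω)| ≤ 4 * DD.δ :=
    (abs_add_le _ _).trans (by linarith)
  calc |DD.M (k + 1) ω - DD.M k ω + (DD.dval (k + 1) ω - DD.dval k ω)| *
        |DD.M (k + 1) ω - DD.M k ω - (DD.dval (k + 1) ω - DD.dval k ω)|
      ≤ 4 * DD.δ * (DD.C₁ * DD.δ ^ 3) :=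
        mul_le_mul h4 h1 (abs_nonneg _) (by linarith [hV.δ_pos])
    _ = 4 * DD.C₁ * DD.δ ^ 4 := by ring

/-- The increments of `Z` are bounded by `b = (4 + 2κ) δ²`. [folklore] -/
theorem abs_Z_succ_sub_le (hV : DD.IsValid N) {k : ℕ} (hk : k < N) (ω : Ω) :
    |DD.Z (k + 1) ω - DD.Z k ω| ≤ DD.bZ := by
  have hM := hV.md.bdd k ω
  have ht1 := hV.t_inc k hk ω
  have ht0 : (0 : ℝ) ≤ (DD.tcap (k + 1) ω : ℝ) - DD.tcap k ω := by
    have := hV.t_mono k ω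
    rw [sub_nonneg]; exact_mod_cast this
  have hsq : (DD.M (k + 1) ω - DD.M k ω) ^ 2 ≤ (2 * DD.δ) ^ 2 := by
    rw [← sq_abs]; exact pow_le_pow_left₀ (abs_nonneg _) hM 2
  have hZ : DD.Z (k + 1) ω - DD.Z k ω =
      (DD.M (k + 1) ω - DD.M k ω) ^ 2 - DD.κ * ((DD.tcap (k + 1) ω : ℝ) - DD.tcap k ω) := by
    simp only [Z, Y, Finset.sum_range_succ]; ring
  rw [hZ, bZ, abs_le]
  have hκ := hV.κ_nonneg
  constructor <;> nlinarith [sq_nonneg (DD.M (k + 1) ω - DD.M k ω), mul_nonneg hκ ht0,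
    mul_le_mul_of_nonneg_left ht1 hκ]

/-- The conditional mean of a difference. [folklore] -/
theorem condMean_sub (k : ℕ) (f g : Ω → ℝ) (l : Λ) :
    DD.condMean k (fun ω ↦ f ω - g ω) l = DD.condMean k f l - DD.condMean k g l := by
  simp only [MartingaleData.condMean, mul_sub, Finset.sum_sub_distrib, sub_div]

/-- **The drift of `Z` is `O(δ³)`**: `|E[Z_{k+1} - Z_k | 𝓕_k]| ≤ C₂ δ³ + 4 C₁ δ⁴` (key estimate
plus `|(ΔM)² - (ΔΔ)²| ≤ 4 C₁ δ⁴`; Lawler–Schramm–Werner: "`E[Z_{n+1} - Z_n | 𝓕_n] ≤ O(δ³)`").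
[cite: LawlerSchrammWerner2004, Theorem 3.7] -/
theorem abs_drift_Z_le (hV : DD.IsValid N) {k : ℕ} (hk : k < N) (ω : Ω) :
    |DD.drift DD.Z k ω| ≤ DD.dZ := by
  set l := DD.H k ω
  have hZ : (fun ω' ↦ DD.Z (k + 1) ω' - DD.Z k ω') = fun ω' ↦
      ((DD.dval (k + 1) ω' - DD.dval k ω') ^ 2 - DD.κ * ((DD.tcap (k + 1) ω' : ℝ) - DD.tcap k ω')) +
      ((DD.M (k + 1) ω' - DD.M k ω') ^ 2 - (DD.dval (k + 1) ω' - DD.dval k ω') ^ 2) := by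
    funext ω'
    simp only [Z, Y, Finset.sum_range_succ]; ring
  rw [MartingaleData.drift, hZ]
  change |DD.condMean k ((fun ω' ↦ (DD.dval (k + 1) ω' - DD.dval k ω') ^ 2 -
      DD.κ * ((DD.tcap (k + 1) ω' : ℝ) - DD.tcap k ω')) +
    (fun ω' ↦ (DD.M (k + 1) ω' - DD.M k ω') ^ 2 - (DD.dval (k + 1) ω' - DD.dval k ω') ^ 2)) l| ≤ _
  rw [MartingaleData.condMean_add]
  refine (abs_add_le _ _).trans (add_le_add (hV.key k hk l) ?_)
  have h4 : (0 : ℝ) ≤ 4 * DD.C₁ * DD.δ ^ 4 :=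
    mul_nonneg (mul_nonneg (by norm_num) hV.C₁_nonneg) (pow_nonneg hV.δ_pos.le 4)
  exact MartingaleData.abs_condMean_le (D := DD.toMartingaleData) k h4
    fun ω' _ ↦ abs_M_sq_sub_d_sq_le hV hk ω'

/-- `Z` is adapted and starts at `0`. [folklore] -/
theorem isAdaptedSeq_Z (hV : DD.IsValid N) : DD.IsAdaptedSeq DD.Z := by
  intro k ω ω' h
  simp only [Z, Y]
  rw [hV.t_adapt k ω ω' h, Finset.sum_congr rfl fun j hj ↦ ?_]
  have hj : j < k := Finset.mem_range.1 hj
  rw [hV.md.adapted (hV.md.refine (Nat.succ_le_of_lt hj) h), hV.md.adapted (hV.md.refine hj.le h)]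

/-- `Z 0 = 0`. [folklore] -/
theorem Z_zero (hV : DD.IsValid N) (ω : Ω) : DD.Z 0 ω = 0 := by
  simp [Z, Y, hV.t_zero ω]

/-- **The capacity at the horizon is large on the good event**: if
`|Y_k - κ t_{m_k}| < λ + N d` for all `k ≤ N`, the lower bound `(ΔΔ)² + Δt ≥ δ²` holds before `N`, and `(κ+1) T + λ + N d ≤ N (δ² - 4 C₁ δ⁴)`, then
`T < t_{m_N}` ("Summing gives `Y_N + t_{m_N} ≥ N δ² ≥ 10 T`. Therefore …
`P[t_{m_N} < 2T] = O(Tδ)`"). [cite: LawlerSchrammWerner2004, Theorem 3.7] -/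
theorem lt_tcap_of_good (hV : DD.IsValid N) {lam T : ℝ} {ω : Ω}
    (hgood : ∀ k ≤ N, |DD.Z k ω| < lam + N * DD.dZ) (hlower : ω ∉ DD.lowerFailSet N)
    (hN : (DD.κ + 1) * T + lam + N * DD.dZ ≤ N * (DD.δ ^ 2 - 4 * DD.C₁ * DD.δ ^ 4)) :
    T < (DD.tcap N ω : ℝ) := by
  have hlow : ∀ k < N, DD.δ ^ 2 ≤
      (DD.dval (k + 1) ω - DD.dval k ω) ^ 2 + ((DD.tcap (k + 1) ω : ℝ) - DD.tcap k ω) := by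
    intro k hk
    by_contra h
    exact hlower ⟨k, hk, not_le.1 h⟩
  -- `Y_N + t_N ≥ N (δ² - 4 C₁ δ⁴)`
  have hsum : ∀ n ≤ N, (n : ℝ) * (DD.δ ^ 2 - 4 * DD.C₁ * DD.δ ^ 4) ≤ DD.Y n ω + DD.tcap n ω := by
    intro n hn
    induction n with
    | zero => simp [Y, hV.t_zero ω]
    | succ n ih =>
      have hn' : n < N := Nat.lt_of_succ_le hn
      have h1 := ih hn'.le
      have h2 := hlow n hn'
      have h3 := abs_M_sq_sub_d_sq_le hV hn' ω
      rw [abs_le] at h3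
      have hY : DD.Y (n + 1) ω = DD.Y n ω + (DD.M (n + 1) ω - DD.M n ω) ^ 2 := by
        simp [Y, Finset.sum_range_succ]
      rw [hY]; push_cast
      nlinarith [h3.1]
  have h1 := hsum N le_rfl
  have h2 := hgood N le_rfl
  rw [abs_lt, Z] at h2
  have hκ := hV.κ_nonneg
  nlinarith [h2.2]

/-! ### The first maximal inequality: `Y_k ≈ κ t_{m_k}` -/

variable [MeasurableSingletonClass Ω]

/-- **`Y_k` stays close to `κ t_{m_k}`**: for `λ > 0`,
`P{∃ k ≤ N, λ + N d ≤ |Y_k - κ t_{m_k}|} ≤ N b² / λ²` with `b = (4+2κ)δ²`, `d = C₂ δ³ + 4 C₁ δ⁴`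
(Kolmogorov's inequality for the compensated `Z`). Lawler–Schramm–Werner (2004), §3.3, display
`P[max_{n≤N} |Y_n - 2 t_{m_n}| > δ^{1/2}] = O(N δ³)`. [cite: LawlerSchrammWerner2004, Theorem 3.7] -/
theorem measureReal_max_Z_ge_le (hV : DD.IsValid N) {lam : ℝ} (hlam : 0 < lam) :
    DD.P.real {ω | ∃ k ≤ N, lam + N * DD.dZ ≤ |DD.Z k ω|} ≤ N * DD.bZ ^ 2 / lam ^ 2 :=
  MartingaleData.measureReal_max_ge_le_of_drift hV.md (isAdaptedSeq_Z hV) (Z_zero hV)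
    (by have := hV.δ_pos; have := hV.C₁_nonneg; have := hV.C₂_nonneg; rw [dZ]; positivity)
    (fun k hk ω ↦ abs_Z_succ_sub_le hV hk ω) (fun k hk ω ↦ abs_drift_Z_le hV hk ω) hlam

/-- **The horizon capacity exceeds `T` off `lowerFailSet`, except on the first Doob event**
(the truncation-friendly form of `lt_tcap_of_good`, for the proof of Thm. 4.4, arXiv p. 23,
where the data are frozen from the first index at which the inner radius or the harmonic measure
condition fails: "define `T₀ := min{T, t_k}`"): with `(κ+1) T + λ + N d ≤ N (δ² - 4 C₁ δ⁴)`,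
`P({t_{m_N} ≤ T} ∖ lowerFailSet N) ≤ N b² / λ²`. [cite: LawlerSchrammWerner2004, Thm. 4.4] -/
theorem measure_tcap_le_diff_lowerFailSet_le (hV : DD.IsValid N) {lam T : ℝ} (hlam : 0 < lam)
    (hN : (DD.κ + 1) * T + lam + N * DD.dZ ≤ N * (DD.δ ^ 2 - 4 * DD.C₁ * DD.δ ^ 4)) :
    DD.P ({ω | (DD.tcap N ω : ℝ) ≤ T} \ DD.lowerFailSet N) ≤
      ENNReal.ofReal (N * DD.bZ ^ 2 / lam ^ 2) := by
  haveI := hV.md.prob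
  have hsub : {ω | (DD.tcap N ω : ℝ) ≤ T} \ DD.lowerFailSet N ⊆
      {ω | ∃ k ≤ N, lam + N * DD.dZ ≤ |DD.Z k ω|} := by
    rintro ω ⟨hT, hlow⟩
    by_contra h
    simp only [mem_setOf_eq, not_exists, not_and, not_le] at h
    exact absurd (lt_tcap_of_good hV h hlow hN) (not_lt.2 hT)
  calc DD.P ({ω | (DD.tcap N ω : ℝ) ≤ T} \ DD.lowerFailSet N)
      ≤ DD.P {ω | ∃ k ≤ N, lam + N * DD.dZ ≤ |DD.Z k ω|} := measure_mono hsub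
    _ = ENNReal.ofReal (DD.P.real {ω | ∃ k ≤ N, lam + N * DD.dZ ≤ |DD.Z k ω|}) := by
        rw [measureReal_def, ENNReal.ofReal_toReal (measure_ne_top _ _)]
    _ ≤ ENNReal.ofReal (N * DD.bZ ^ 2 / lam ^ 2) :=
        ENNReal.ofReal_le_ofReal (measureReal_max_Z_ge_le hV hlam)

end DrivingData

/-! ### Time scaling of paths -/

/-- The time-scaled path `t ↦ p (κ t)`. [folklore] -/
def timeScale (κ : ℝ≥0) (p : C(ℝ≥0, ℝ)) : C(ℝ≥0, ℝ) :=
  ⟨fun t ↦ p (κ * t), p.continuous.comp (continuous_const.mul continuous_id)⟩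

/-- Value of the time-scaled path. [folklore] -/
@[simp] theorem timeScale_apply (κ : ℝ≥0) (p : C(ℝ≥0, ℝ)) (t : ℝ≥0) : timeScale κ p t = p (κ * t) := rfl

/-- Time scaling is continuous on path space. [folklore] -/
theorem continuous_timeScale (κ : ℝ≥0) : Continuous (timeScale κ) :=
  ContinuousMap.continuous_precomp ⟨fun t ↦ κ * t, continuous_const.mul continuous_id⟩

/-! ### The engine -/

section Engine

variable [MeasurableSpace C(ℝ≥0, ℝ)] [BorelSpace C(ℝ≥0, ℝ)]
variable {Ω Λ : Type} [Fintype Ω] [MeasurableSpace Ω] [MeasurableSingletonClass Ω]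
  [DecidableEq Λ] [Countable Λ] [MeasurableSpace Λ] [MeasurableSingletonClass Λ]
  {DD : DrivingData Ω Λ} {N : ℕ} (E : EmbeddingWitness DD.toMartingaleData N)

namespace EmbeddingWitness

omit [BorelSpace C(ℝ≥0, ℝ)] [MeasurableSingletonClass Ω] [Countable Λ] [MeasurableSingletonClass Λ] in
/-- **The time comparison on the good events** (deterministic core of the engine): if at the
sample `ω`, `|Z_k(X ω)| < λ + N d` and `|τ_k ω - Y_k(X ω)| < λ` for all `k ≤ N`, then for every
`s ≤ T` (with `(κ+1) T + λ + N d ≤ N (δ² - 4 C₁ δ⁴)`) there is `k < N` with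
`t_{m_k} ≤ s ≤ t_{m_{k+1}}` and `|τ_k ω - κ s| < 2λ + N d + 2κδ²` ("Combining … leads to
`P[max_{n≤N} |τ_n - 2 t_{m_n}| > 2δ^{1/2}] = O(Tδ)`"). [cite: LawlerSchrammWerner2004, Theorem 3.7] -/
theorem exists_index_of_good (hV : DD.IsValid N) {lam T : ℝ} {ω : E.Ω'}
    (hZ : ∀ k ≤ N, |DD.Z k (E.X ω)| < lam + N * DD.dZ)
    (hτ : ∀ k ≤ N, |(E.τ k ω : ℝ) - DD.Y k (E.X ω)| < lam) (hlower : E.X ω ∉ DD.lowerFailSet N)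
    (hN : (DD.κ + 1) * T + lam + N * DD.dZ ≤ N * (DD.δ ^ 2 - 4 * DD.C₁ * DD.δ ^ 4))
    {s : ℝ≥0} (hs : (s : ℝ) ≤ T) :
    ∃ k < N, DD.tcap k (E.X ω) ≤ s ∧ s ≤ DD.tcap (k + 1) (E.X ω) ∧
      |(E.τ k ω : ℝ) - DD.κ * s| < 2 * lam + N * DD.dZ + 2 * DD.κ * DD.δ ^ 2 := by
  set ω₀ := E.X ω
  have hT : T < (DD.tcap N ω₀ : ℝ) := DrivingData.lt_tcap_of_good hV hZ hlower hN
  -- the last index whose capacity is `≤ s`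
  classical
  have hne : ((Finset.range (N + 1)).filter fun k ↦ DD.tcap k ω₀ ≤ s).Nonempty :=
    ⟨0, Finset.mem_filter.2 ⟨Finset.mem_range.2 (Nat.succ_pos N), by rw [hV.t_zero ω₀]; exact bot_le⟩⟩
  set k := ((Finset.range (N + 1)).filter fun k ↦ DD.tcap k ω₀ ≤ s).max' hne with hkdef
  have hkmem := Finset.max'_mem _ hne
  rw [← hkdef, Finset.mem_filter, Finset.mem_range] at hkmem
  have hkN : k < N := by
    rcases Nat.lt_succ_iff.1 hkmem.1 |>.lt_or_eq with h | h
    · exact h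
    · exfalso
      have : (DD.tcap N ω₀ : ℝ) ≤ s := by rw [← h]; exact_mod_cast hkmem.2
      linarith
  have hk1 : s ≤ DD.tcap (k + 1) ω₀ := by
    by_contra h
    rw [not_le] at h
    have hmem : k + 1 ∈ (Finset.range (N + 1)).filter fun k ↦ DD.tcap k ω₀ ≤ s :=
      Finset.mem_filter.2 ⟨Finset.mem_range.2 (Nat.succ_lt_succ hkN), h.le⟩
    have := Finset.le_max' _ _ hmem
    rw [← hkdef] at this
    omega
  refine ⟨k, hkN, hkmem.2, hk1, ?_⟩
  have h1 := hτ k hkN.le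
  have h2 := hZ k hkN.le
  rw [DrivingData.Z] at h2
  have h3 : (DD.tcap k ω₀ : ℝ) ≤ s := by exact_mod_cast hkmem.2
  have h4 : (s : ℝ) ≤ DD.tcap (k + 1) ω₀ := by exact_mod_cast hk1
  have h5 := hV.t_inc k hkN ω₀
  have hκ := hV.κ_nonneg
  rw [abs_lt] at h1 h2 ⊢
  constructor <;> nlinarith [mul_le_mul_of_nonneg_left h3 hκ, mul_le_mul_of_nonneg_left h4 hκ,
    mul_le_mul_of_nonneg_left h5 hκ]

omit [BorelSpace C(ℝ≥0, ℝ)] [MeasurableSingletonClass Ω] [Countable Λ] [MeasurableSingletonClass Λ] in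
/-- **The bad event of the engine is covered by the three controlled events**: outside
`{∃ k ≤ N, λ + N d ≤ |Z_k(X)|}`, `{∃ k ≤ N, λ ≤ |τ_k - Y_k(X)|}`, the modulus event
`{B ∈ badModulusSet (κT + η) η (ε/2)}`, the pulled-back `lowerFailSet` and the null set where an
embedding identity `B(τ_k) = M_k(X)` fails, one has `|drv(X)(s) - B(κ s)| < ε` for all `s ≤ T`
(`2δ`-oscillation of `W`, `|Δ_{m_k} - M_k| ≤ C₁ δ³ N`, `B_{τ_k} = M_k`, time comparison,
continuity of `B`). Lawler–Schramm–Werner (2004), end of the proof of Thm. 3.7.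
[cite: LawlerSchrammWerner2004, Theorem 3.7] -/
theorem abs_drv_sub_B_lt_of_good (hV : DD.IsValid N) {lam T ε : ℝ} {ω : E.Ω'}
    (hZ : ∀ k ≤ N, |DD.Z k (E.X ω)| < lam + N * DD.dZ)
    (hτ : ∀ k ≤ N, |(E.τ k ω : ℝ) - DD.Y k (E.X ω)| < lam)
    (hval : ∀ k ≤ N, E.B ω (E.τ k ω) = DD.M k (E.X ω)) (hlower : E.X ω ∉ DD.lowerFailSet N)
    (hmod : E.B ω ∉ badModulusSet (DD.κ * T + (2 * lam + N * DD.dZ + 2 * DD.κ * DD.δ ^ 2))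
      (2 * lam + N * DD.dZ + 2 * DD.κ * DD.δ ^ 2) (ε / 2))
    (hN : (DD.κ + 1) * T + lam + N * DD.dZ ≤ N * (DD.δ ^ 2 - 4 * DD.C₁ * DD.δ ^ 4))
    (hsmall : 2 * DD.δ + DD.C₁ * DD.δ ^ 3 * N ≤ ε / 2)
    {s : ℝ≥0} (hs : (s : ℝ) ≤ T) :
    |DD.drv (E.X ω) s - E.B ω (⟨DD.κ, hV.κ_nonneg⟩ * s)| < ε := by
  set ω₀ := E.X ω
  set η := 2 * lam + N * DD.dZ + 2 * DD.κ * DD.δ ^ 2 with hη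
  obtain ⟨k, hkN, hk0, hk1, htime⟩ := E.exists_index_of_good hV hZ hτ hlower hN hs
  -- the four pieces
  have h1 : |DD.drv ω₀ s - DD.dval k ω₀| ≤ 2 * DD.δ := hV.drv_osc k hkN ω₀ s hk0 hk1
  have h2 : |DD.dval k ω₀ - DD.M k ω₀| ≤ DD.C₁ * DD.δ ^ 3 * N :=
    (DrivingData.abs_dval_sub_M_le hV hkN.le ω₀).trans
      (mul_le_mul_of_nonneg_left (Nat.cast_le.2 hkN.le)
        (mul_nonneg hV.C₁_nonneg (pow_nonneg hV.δ_pos.le 3)))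
  have h3 : DD.M k ω₀ = E.B ω (E.τ k ω) := (hval k hkN.le).symm
  -- continuity of `B` between the two times
  set v : ℝ≥0 := ⟨DD.κ, hV.κ_nonneg⟩ * s with hv
  have hvR : (v : ℝ) = DD.κ * s := by rw [hv]; push_cast; rfl
  have hlam : 0 < lam := by
    have := hτ 0 (Nat.zero_le N)
    exact lt_of_le_of_lt (abs_nonneg _) this
  have hηpos : 0 ≤ η := by
    have := hV.δ_pos; have := hV.κ_nonneg
    have : 0 ≤ DD.dZ := by rw [DrivingData.dZ]; have := hV.C₁_nonneg; have := hV.C₂_nonneg; positivity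
    rw [hη]; positivity
  have h4 : |E.B ω (E.τ k ω) - E.B ω v| < ε / 2 := by
    by_contra hcon
    rw [not_lt] at hcon
    apply hmod
    refine ⟨E.τ k ω, v, ?_, ?_, ?_, ?_⟩
    · rw [abs_lt] at htime
      have : DD.κ * (s : ℝ) ≤ DD.κ * T := mul_le_mul_of_nonneg_left hs hV.κ_nonneg
      linarith
    · rw [hvR]
      have : DD.κ * (s : ℝ) ≤ DD.κ * T := mul_le_mul_of_nonneg_left hs hV.κ_nonneg
      linarith
    · rw [NNReal.dist_eq, hvR]
      exact htime.le
    · rwa [Real.dist_eq]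
  -- assemble
  have hsplit : DD.drv ω₀ s - E.B ω v = (DD.drv ω₀ s - DD.dval k ω₀) + (DD.dval k ω₀ - DD.M k ω₀) +
      (E.B ω (E.τ k ω) - E.B ω v) := by rw [h3]; ring
  rw [hsplit]
  calc |DD.drv ω₀ s - DD.dval k ω₀ + (DD.dval k ω₀ - DD.M k ω₀) + (E.B ω (E.τ k ω) - E.B ω v)|
      ≤ |DD.drv ω₀ s - DD.dval k ω₀| + |DD.dval k ω₀ - DD.M k ω₀| + |E.B ω (E.τ k ω) - E.B ω v| :=
        (abs_add_le _ _).trans (add_le_add (abs_add_le _ _) le_rfl)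
    _ < 2 * DD.δ + DD.C₁ * DD.δ ^ 3 * N + ε / 2 := by linarith
    _ ≤ ε := by linarith

/-- **The engine of Lawler–Schramm–Werner (2004), §3.3 / Thm. 4.4** (quantitative form): for
driving data satisfying the hypotheses up to the horizon `N`, a Skorokhod embedding witness
`(Q, X, B, τ, …)`, and parameters `λ > 0`, `T`, `ε` with `2δ + C₁ δ³ N ≤ ε/2` and
`(κ+1) T + λ + N d ≤ N (δ² - 4 C₁ δ⁴)` (`d = C₂ δ³ + 4 C₁ δ⁴`),

`Q{∃ s ≤ T, ε ≤ |W_X(s) - B(κ s)|} ≤ N b²/λ² + N (512 C₄ + 32) δ⁴/λ² + μ_W(badModulusSet (κT+η) η (ε/2))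
  + P(lowerFailSet N)`

with `b = (4+2κ)δ²`, `η = 2λ + N d + 2κδ²` and `μ_W` the Wiener law on path space: the sum of the
two Doob bounds, the modulus-of-continuity probability of Brownian motion, and the probability that
the defining lower bound of the stopping indices fails before `N` (zero for the data of §3.3).
[cite: LawlerSchrammWerner2004, Theorem 3.7] -/
theorem measure_sup_drv_sub_B_ge_le (hV : DD.IsValid N) {lam T ε : ℝ} (hlam : 0 < lam)
    (hN : (DD.κ + 1) * T + lam + N * DD.dZ ≤ N * (DD.δ ^ 2 - 4 * DD.C₁ * DD.δ ^ 4))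
    (hsmall : 2 * DD.δ + DD.C₁ * DD.δ ^ 3 * N ≤ ε / 2) :
    E.Q {ω | ∃ s : ℝ≥0, (s : ℝ) ≤ T ∧ ε ≤ |DD.drv (E.X ω) s - E.B ω (⟨DD.κ, hV.κ_nonneg⟩ * s)|} ≤
      ENNReal.ofReal (N * DD.bZ ^ 2 / lam ^ 2) +
      ENNReal.ofReal (N * ((512 * C4 + 32) * DD.δ ^ 4) / lam ^ 2) +
      wienerLawC (badModulusSet (DD.κ * T + (2 * lam + N * DD.dZ + 2 * DD.κ * DD.δ ^ 2))
        (2 * lam + N * DD.dZ + 2 * DD.κ * DD.δ ^ 2) (ε / 2)) +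
      DD.P (DD.lowerFailSet N) := by
  haveI := hV.md.prob
  set η := 2 * lam + N * DD.dZ + 2 * DD.κ * DD.δ ^ 2 with hη
  -- the three controlled events and the null event
  set A₁ : Set E.Ω' := {ω | ∃ k ≤ N, lam + N * DD.dZ ≤ |DD.Z k (E.X ω)|} with hA₁
  set A₂ : Set E.Ω' := {ω | ∃ k ≤ N, lam ≤ |(E.τ k ω : ℝ) - DD.Y k (E.X ω)|} with hA₂
  set A₃ : Set E.Ω' := {ω | E.B ω ∈ badModulusSet (DD.κ * T + η) η (ε / 2)} with hA₃
  set A₄ : Set E.Ω' := {ω | ¬ ∀ k ∈ Finset.range (N + 1), E.B ω (E.τ k ω) = DD.M k (E.X ω)} with hA₄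
  set A₅ : Set E.Ω' := E.X ⁻¹' DD.lowerFailSet N with hA₅
  have hcover : {ω | ∃ s : ℝ≥0, (s : ℝ) ≤ T ∧ ε ≤ |DD.drv (E.X ω) s - E.B ω (⟨DD.κ, hV.κ_nonneg⟩ * s)|}
      ⊆ A₁ ∪ A₂ ∪ A₃ ∪ A₄ ∪ A₅ := by
    intro ω hω
    by_contra hnot
    simp only [mem_union, not_or] at hnot
    obtain ⟨⟨⟨⟨h1, h2⟩, h3⟩, h4⟩, h5⟩ := hnot
    simp only [hA₁, hA₂, hA₄, mem_setOf_eq, not_exists, not_and, not_le, not_not] at h1 h2 h4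
    obtain ⟨s, hs, hε⟩ := hω
    have hval : ∀ k ≤ N, E.B ω (E.τ k ω) = DD.M k (E.X ω) :=
      fun k hk ↦ h4 k (Finset.mem_range.2 (Nat.lt_succ_of_le hk))
    have := E.abs_drv_sub_B_lt_of_good hV h1 h2 hval h5 h3 hN hsmall hs
    linarith
  -- measure bounds
  have hB₁ : E.Q A₁ ≤ ENNReal.ofReal (N * DD.bZ ^ 2 / lam ^ 2) := by
    have hpre : A₁ = E.X ⁻¹' {ω₀ | ∃ k ≤ N, lam + N * DD.dZ ≤ |DD.Z k ω₀|} := rfl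
    rw [hpre, ← Measure.map_apply E.hX (Set.toFinite _).measurableSet, E.lawX,
      ← ENNReal.ofReal_toReal (measure_ne_top _ _), ← measureReal_def]
    exact ENNReal.ofReal_le_ofReal (DrivingData.measureReal_max_Z_ge_le hV hlam)
  have hB₂ : E.Q A₂ ≤ ENNReal.ofReal (N * ((512 * C4 + 32) * DD.δ ^ 4) / lam ^ 2) := by
    rw [← ENNReal.ofReal_toReal (measure_ne_top _ _), ← measureReal_def]
    exact ENNReal.ofReal_le_ofReal (E.measureReal_max_tau_sub_quad_ge_le hV.md hlam)
  have hB₃ : E.Q A₃ = wienerLawC (badModulusSet (DD.κ * T + η) η (ε / 2)) := by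
    rw [hA₃, ← E.lawB, Measure.map_apply E.hB (isClosed_badModulusSet _ _ _).measurableSet]
    rfl
  have hB₄ : E.Q A₄ = 0 := by
    have h : ∀ᵐ ω ∂E.Q, ∀ k ∈ Finset.range (N + 1), E.B ω (E.τ k ω) = DD.M k (E.X ω) :=
      (ae_ball_iff (Finset.countable_toSet _)).2 fun k hk ↦
        E.val k (Nat.lt_succ_iff.1 (Finset.mem_range.1 hk))
    exact ae_iff.1 h
  have hB₅ : E.Q A₅ = DD.P (DD.lowerFailSet N) := by
    rw [hA₅, ← Measure.map_apply E.hX (Set.toFinite _).measurableSet, E.lawX]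
  calc E.Q {ω | ∃ s : ℝ≥0, (s : ℝ) ≤ T ∧ ε ≤ |DD.drv (E.X ω) s - E.B ω (⟨DD.κ, hV.κ_nonneg⟩ * s)|}
      ≤ E.Q (A₁ ∪ A₂ ∪ A₃ ∪ A₄ ∪ A₅) := measure_mono hcover
    _ ≤ E.Q (A₁ ∪ A₂ ∪ A₃ ∪ A₄) + E.Q A₅ := measure_union_le _ _
    _ ≤ E.Q (A₁ ∪ A₂ ∪ A₃) + E.Q A₄ + E.Q A₅ := add_le_add (measure_union_le _ _) le_rfl
    _ ≤ E.Q (A₁ ∪ A₂) + E.Q A₃ + E.Q A₄ + E.Q A₅ :=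
        add_le_add (add_le_add (measure_union_le _ _) le_rfl) le_rfl
    _ ≤ E.Q A₁ + E.Q A₂ + E.Q A₃ + E.Q A₄ + E.Q A₅ :=
        add_le_add (add_le_add (add_le_add (measure_union_le _ _) le_rfl) le_rfl) le_rfl
    _ ≤ _ := by
        rw [hB₃, hB₄, add_zero, hB₅]
        exact add_le_add (add_le_add (add_le_add hB₁ hB₂) le_rfl) le_rfl

/-! ### The truncation-friendly engine: deviation up to `min(T, t_{m_N})`

In the proof of Thm. 4.4 (arXiv Thm. 23, p. 23) Lawler–Schramm–Werner run the argument of §3.3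
only up to `T₀ := min{T, t_k}`, `k` the first index at which the inner radius of `D_k` or the
harmonic measure condition fails ("one has to be a little careful because it may happen that `0`
is 'swallowed' before time `T` … Exactly as in the proof of Theorem 3.7, Proposition 4.2 implies
that we may couple `W` with a Brownian motion `B` in such a way that
`P[sup{|W(t) - B(8t)| : t ∈ [0, T₀]} > ε₂/3] < ε₃/3`"). For driving data frozen from such an
index on (zero increments satisfy the martingale and key hypotheses trivially, but not the lower
bound `(ΔΔ)² + Δt ≥ δ²`), the following variant bounds the deviation over `s ≤ min(T, t_{m_N})`
by the two Doob terms and the modulus term alone — no `lowerFailSet` term; the lower bound enters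
only `DrivingData.measure_tcap_le_diff_lowerFailSet_le` (`t_{m_N} > T` off `lowerFailSet` and the
first Doob event). -/

omit [BorelSpace C(ℝ≥0, ℝ)] [MeasurableSingletonClass Ω] [Countable Λ] [MeasurableSingletonClass Λ] in
/-- **Time comparison up to the horizon capacity**, without the lower bound of the stopping
indices: if `|Z_k(X ω)| < λ + N d` and `|τ_k ω - Y_k(X ω)| < λ` for all `k ≤ N` (`N ≥ 1`), then
for every `s ≤ t_{m_N}(X ω)` there is `k < N` with `t_{m_k} ≤ s ≤ t_{m_{k+1}}` and
`|τ_k ω - κ s| < 2λ + N d + 2κδ²`. [cite: LawlerSchrammWerner2004, Thm. 4.4] -/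
theorem exists_index_of_le_tcap (hV : DD.IsValid N) (hN1 : 1 ≤ N) {lam : ℝ} {ω : E.Ω'}
    (hZ : ∀ k ≤ N, |DD.Z k (E.X ω)| < lam + N * DD.dZ)
    (hτ : ∀ k ≤ N, |(E.τ k ω : ℝ) - DD.Y k (E.X ω)| < lam)
    {s : ℝ≥0} (hs : s ≤ DD.tcap N (E.X ω)) :
    ∃ k < N, DD.tcap k (E.X ω) ≤ s ∧ s ≤ DD.tcap (k + 1) (E.X ω) ∧
      |(E.τ k ω : ℝ) - DD.κ * s| < 2 * lam + N * DD.dZ + 2 * DD.κ * DD.δ ^ 2 := by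
  set ω₀ := E.X ω
  classical
  have hne : ((Finset.range N).filter fun k ↦ DD.tcap k ω₀ ≤ s).Nonempty :=
    ⟨0, Finset.mem_filter.2 ⟨Finset.mem_range.2 hN1, by rw [hV.t_zero ω₀]; exact bot_le⟩⟩
  set k := ((Finset.range N).filter fun k ↦ DD.tcap k ω₀ ≤ s).max' hne with hkdef
  have hkmem := Finset.max'_mem _ hne
  rw [← hkdef, Finset.mem_filter, Finset.mem_range] at hkmem
  have hkN : k < N := hkmem.1
  have hk1 : s ≤ DD.tcap (k + 1) ω₀ := by
    by_contra h
    rw [not_le] at h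
    have hk1N : k + 1 ≤ N := hkN
    rcases hk1N.lt_or_eq with hlt | heq
    · have hmem : k + 1 ∈ (Finset.range N).filter fun k ↦ DD.tcap k ω₀ ≤ s :=
        Finset.mem_filter.2 ⟨Finset.mem_range.2 hlt, h.le⟩
      have := Finset.le_max' _ _ hmem
      rw [← hkdef] at this
      omega
    · rw [heq] at h
      exact absurd hs (not_le.2 h)
  refine ⟨k, hkN, hkmem.2, hk1, ?_⟩
  have h1 := hτ k hkN.le
  have h2 := hZ k hkN.le
  rw [DrivingData.Z] at h2
  have h3 : (DD.tcap k ω₀ : ℝ) ≤ s := by exact_mod_cast hkmem.2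
  have h4 : (s : ℝ) ≤ DD.tcap (k + 1) ω₀ := by exact_mod_cast hk1
  have h5 := hV.t_inc k hkN ω₀
  have hκ := hV.κ_nonneg
  rw [abs_lt] at h1 h2 ⊢
  constructor <;> nlinarith [mul_le_mul_of_nonneg_left h3 hκ, mul_le_mul_of_nonneg_left h4 hκ,
    mul_le_mul_of_nonneg_left h5 hκ]

omit [BorelSpace C(ℝ≥0, ℝ)] [MeasurableSingletonClass Ω] [Countable Λ] [MeasurableSingletonClass Λ] in
/-- **Off the controlled events the deviation is `< ε` up to `min(T, t_{m_N})`** (the variant of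
`abs_drv_sub_B_lt_of_good` without the lower bound of the stopping indices): outside
`{∃ k ≤ N, λ + N d ≤ |Z_k(X)|}`, `{∃ k ≤ N, λ ≤ |τ_k - Y_k(X)|}`, the modulus event and the null
set where an embedding identity fails, `|drv(X)(s) - B(κ s)| < ε` for all `s ≤ T` with
`s ≤ t_{m_N}(X)`. [cite: LawlerSchrammWerner2004, Thm. 4.4] -/
theorem abs_drv_sub_B_lt_of_le_tcap (hV : DD.IsValid N) (hN1 : 1 ≤ N) {lam T ε : ℝ} {ω : E.Ω'}
    (hZ : ∀ k ≤ N, |DD.Z k (E.X ω)| < lam + N * DD.dZ)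
    (hτ : ∀ k ≤ N, |(E.τ k ω : ℝ) - DD.Y k (E.X ω)| < lam)
    (hval : ∀ k ≤ N, E.B ω (E.τ k ω) = DD.M k (E.X ω))
    (hmod : E.B ω ∉ badModulusSet (DD.κ * T + (2 * lam + N * DD.dZ + 2 * DD.κ * DD.δ ^ 2))
      (2 * lam + N * DD.dZ + 2 * DD.κ * DD.δ ^ 2) (ε / 2))
    (hsmall : 2 * DD.δ + DD.C₁ * DD.δ ^ 3 * N ≤ ε / 2)
    {s : ℝ≥0} (hs : (s : ℝ) ≤ T) (hsN : s ≤ DD.tcap N (E.X ω)) :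
    |DD.drv (E.X ω) s - E.B ω (⟨DD.κ, hV.κ_nonneg⟩ * s)| < ε := by
  set ω₀ := E.X ω
  set η := 2 * lam + N * DD.dZ + 2 * DD.κ * DD.δ ^ 2 with hη
  obtain ⟨k, hkN, hk0, hk1, htime⟩ := E.exists_index_of_le_tcap hV hN1 hZ hτ hsN
  have h1 : |DD.drv ω₀ s - DD.dval k ω₀| ≤ 2 * DD.δ := hV.drv_osc k hkN ω₀ s hk0 hk1
  have h2 : |DD.dval k ω₀ - DD.M k ω₀| ≤ DD.C₁ * DD.δ ^ 3 * N :=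
    (DrivingData.abs_dval_sub_M_le hV hkN.le ω₀).trans
      (mul_le_mul_of_nonneg_left (Nat.cast_le.2 hkN.le)
        (mul_nonneg hV.C₁_nonneg (pow_nonneg hV.δ_pos.le 3)))
  have h3 : DD.M k ω₀ = E.B ω (E.τ k ω) := (hval k hkN.le).symm
  set v : ℝ≥0 := ⟨DD.κ, hV.κ_nonneg⟩ * s with hv
  have hvR : (v : ℝ) = DD.κ * s := by rw [hv]; push_cast; rfl
  have h4 : |E.B ω (E.τ k ω) - E.B ω v| < ε / 2 := by
    by_contra hcon
    rw [not_lt] at hcon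
    apply hmod
    refine ⟨E.τ k ω, v, ?_, ?_, ?_, ?_⟩
    · rw [abs_lt] at htime
      have : DD.κ * (s : ℝ) ≤ DD.κ * T := mul_le_mul_of_nonneg_left hs hV.κ_nonneg
      linarith
    · rw [hvR]
      have : DD.κ * (s : ℝ) ≤ DD.κ * T := mul_le_mul_of_nonneg_left hs hV.κ_nonneg
      have hη0 : 0 ≤ η := by
        have hl : 0 < lam := lt_of_le_of_lt (abs_nonneg _) (hτ 0 (Nat.zero_le N))
        have : 0 ≤ DD.dZ := by
          rw [DrivingData.dZ]; have := hV.C₁_nonneg; have := hV.C₂_nonneg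
          have := hV.δ_pos; positivity
        have := hV.δ_pos; have := hV.κ_nonneg
        rw [hη]; positivity
      linarith
    · rw [NNReal.dist_eq, hvR]
      exact htime.le
    · rwa [Real.dist_eq]
  have hsplit : DD.drv ω₀ s - E.B ω v = (DD.drv ω₀ s - DD.dval k ω₀) + (DD.dval k ω₀ - DD.M k ω₀) +
      (E.B ω (E.τ k ω) - E.B ω v) := by rw [h3]; ring
  rw [hsplit]
  calc |DD.drv ω₀ s - DD.dval k ω₀ + (DD.dval k ω₀ - DD.M k ω₀) + (E.B ω (E.τ k ω) - E.B ω v)|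
      ≤ |DD.drv ω₀ s - DD.dval k ω₀| + |DD.dval k ω₀ - DD.M k ω₀| + |E.B ω (E.τ k ω) - E.B ω v| :=
        (abs_add_le _ _).trans (add_le_add (abs_add_le _ _) le_rfl)
    _ < 2 * DD.δ + DD.C₁ * DD.δ ^ 3 * N + ε / 2 := by linarith
    _ ≤ ε := by linarith

/-- **The engine up to `min(T, t_{m_N})`** (for the proof of Thm. 4.4, arXiv p. 23): for valid
driving data with horizon `N ≥ 1`, a Skorokhod embedding witness, `λ > 0` and
`2δ + C₁ δ³ N ≤ ε/2`,

`Q{∃ s ≤ T, s ≤ t_{m_N}(X), ε ≤ |W_X(s) - B(κ s)|} ≤ N b²/λ² + N (512 C₄ + 32) δ⁴/λ²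
  + μ_W(badModulusSet (κT+η) η (ε/2))`,

`b = (4+2κ)δ²`, `η = 2λ + N d + 2κδ²` — the bound of `measure_sup_drv_sub_B_ge_le` without the
`lowerFailSet` term and without the horizon condition. [cite: LawlerSchrammWerner2004, Thm. 4.4] -/
theorem measure_sup_drv_sub_B_ge_trunc_le (hV : DD.IsValid N) (hN1 : 1 ≤ N) {lam T ε : ℝ}
    (hlam : 0 < lam) (hsmall : 2 * DD.δ + DD.C₁ * DD.δ ^ 3 * N ≤ ε / 2) :
    E.Q {ω | ∃ s : ℝ≥0, (s : ℝ) ≤ T ∧ s ≤ DD.tcap N (E.X ω) ∧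
        ε ≤ |DD.drv (E.X ω) s - E.B ω (⟨DD.κ, hV.κ_nonneg⟩ * s)|} ≤
      ENNReal.ofReal (N * DD.bZ ^ 2 / lam ^ 2) +
      ENNReal.ofReal (N * ((512 * C4 + 32) * DD.δ ^ 4) / lam ^ 2) +
      wienerLawC (badModulusSet (DD.κ * T + (2 * lam + N * DD.dZ + 2 * DD.κ * DD.δ ^ 2))
        (2 * lam + N * DD.dZ + 2 * DD.κ * DD.δ ^ 2) (ε / 2)) := by
  haveI := hV.md.prob
  set η := 2 * lam + N * DD.dZ + 2 * DD.κ * DD.δ ^ 2 with hη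
  set A₁ : Set E.Ω' := {ω | ∃ k ≤ N, lam + N * DD.dZ ≤ |DD.Z k (E.X ω)|} with hA₁
  set A₂ : Set E.Ω' := {ω | ∃ k ≤ N, lam ≤ |(E.τ k ω : ℝ) - DD.Y k (E.X ω)|} with hA₂
  set A₃ : Set E.Ω' := {ω | E.B ω ∈ badModulusSet (DD.κ * T + η) η (ε / 2)} with hA₃
  set A₄ : Set E.Ω' := {ω | ¬ ∀ k ∈ Finset.range (N + 1), E.B ω (E.τ k ω) = DD.M k (E.X ω)} with hA₄
  have hcover : {ω | ∃ s : ℝ≥0, (s : ℝ) ≤ T ∧ s ≤ DD.tcap N (E.X ω) ∧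
      ε ≤ |DD.drv (E.X ω) s - E.B ω (⟨DD.κ, hV.κ_nonneg⟩ * s)|} ⊆ A₁ ∪ A₂ ∪ A₃ ∪ A₄ := by
    intro ω hω
    by_contra hnot
    simp only [mem_union, not_or] at hnot
    obtain ⟨⟨⟨h1, h2⟩, h3⟩, h4⟩ := hnot
    simp only [hA₁, hA₂, hA₄, mem_setOf_eq, not_exists, not_and, not_le, not_not] at h1 h2 h4
    obtain ⟨s, hs, hsN, hε⟩ := hω
    have hval : ∀ k ≤ N, E.B ω (E.τ k ω) = DD.M k (E.X ω) :=
      fun k hk ↦ h4 k (Finset.mem_range.2 (Nat.lt_succ_of_le hk))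
    have := E.abs_drv_sub_B_lt_of_le_tcap hV hN1 h1 h2 hval h3 hsmall hs hsN
    linarith
  have hB₁ : E.Q A₁ ≤ ENNReal.ofReal (N * DD.bZ ^ 2 / lam ^ 2) := by
    have hpre : A₁ = E.X ⁻¹' {ω₀ | ∃ k ≤ N, lam + N * DD.dZ ≤ |DD.Z k ω₀|} := rfl
    rw [hpre, ← Measure.map_apply E.hX (Set.toFinite _).measurableSet, E.lawX,
      ← ENNReal.ofReal_toReal (measure_ne_top _ _), ← measureReal_def]
    exact ENNReal.ofReal_le_ofReal (DrivingData.measureReal_max_Z_ge_le hV hlam)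
  have hB₂ : E.Q A₂ ≤ ENNReal.ofReal (N * ((512 * C4 + 32) * DD.δ ^ 4) / lam ^ 2) := by
    rw [← ENNReal.ofReal_toReal (measure_ne_top _ _), ← measureReal_def]
    exact ENNReal.ofReal_le_ofReal (E.measureReal_max_tau_sub_quad_ge_le hV.md hlam)
  have hB₃ : E.Q A₃ = wienerLawC (badModulusSet (DD.κ * T + η) η (ε / 2)) := by
    rw [hA₃, ← E.lawB, Measure.map_apply E.hB (isClosed_badModulusSet _ _ _).measurableSet]
    rfl
  have hB₄ : E.Q A₄ = 0 := by
    have h : ∀ᵐ ω ∂E.Q, ∀ k ∈ Finset.range (N + 1), E.B ω (E.τ k ω) = DD.M k (E.X ω) :=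
      (ae_ball_iff (Finset.countable_toSet _)).2 fun k hk ↦
        E.val k (Nat.lt_succ_iff.1 (Finset.mem_range.1 hk))
    exact ae_iff.1 h
  calc E.Q {ω | ∃ s : ℝ≥0, (s : ℝ) ≤ T ∧ s ≤ DD.tcap N (E.X ω) ∧
          ε ≤ |DD.drv (E.X ω) s - E.B ω (⟨DD.κ, hV.κ_nonneg⟩ * s)|}
      ≤ E.Q (A₁ ∪ A₂ ∪ A₃ ∪ A₄) := measure_mono hcover
    _ ≤ E.Q (A₁ ∪ A₂ ∪ A₃) + E.Q A₄ := measure_union_le _ _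
    _ ≤ E.Q (A₁ ∪ A₂) + E.Q A₃ + E.Q A₄ := add_le_add (measure_union_le _ _) le_rfl
    _ ≤ E.Q A₁ + E.Q A₂ + E.Q A₃ + E.Q A₄ :=
        add_le_add (add_le_add (measure_union_le _ _) le_rfl) le_rfl
    _ ≤ _ := by
        rw [hB₃, hB₄, add_zero]
        exact add_le_add (add_le_add hB₁ hB₂) le_rfl

end EmbeddingWitness

end Engine

end Literature.Probability.RandomPlanarGeometry.SkorokhodEmbedding

end

/-!
# The driving-function coupling of Lawler–Schramm–Werner (2004), Thms. 3.7 / 4.4: packaging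

Topic `Probability/RandomPlanarGeometry`, sub-namespace `SkorokhodEmbedding`. Everything here is
PROVED; no named fact is introduced.

This part of the file turns the quantitative engine `EmbeddingWitness.measure_sup_drv_sub_B_ge_le` (file
`DrivingConvergenceEngine`) into the shape in which Lawler–Schramm–Werner (2004) state the
convergence of the driving process ("for every `T > 0`, `ε > 0` there is `r₁` such that … there
is a coupling of `γ` with Brownian motion `B(t)` such that
`P[sup{|W(t) - W(0) - B(κ t)| : 0 ≤ t ≤ T} > ε] < ε`", Thm. 3.7 with `κ = 2`, Thm. 4.4 with
`κ = 8`), namely the input shape of the tree's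
`USTPeano.drivingProcess_tendsto_of_coupling`:

* `exists_coupling_le` — for valid driving data and numeric side conditions, a probability measure
  `ρ` on `C × C` with first marginal the law of the driving function, second marginal the law of
  `t ↦ B(κt)`, and `ρ{∃ t ≤ T, ε ≤ dist} ≤` (the engine's bound);
* `wienerLawC_map_timeScale_eight` — for `κ = 8` the second marginal is the tree's
  `preWienerMeasure.map brownianTimeEight`;
* `exists_coupling_trunc_le`, `exists_delta_forall_coupling_trunc_lt` — the truncation-friendly
  coupling on `Ω × C` (Thm. 4.4, arXiv p. 23, `T₀ = min{T, t_k}`): the deviation over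
  `t ≤ min(T, t_{m_N})` (`DrivingData.truncDevSet`) is `< ε₃` for `δ ≤ δ₀`, and
  `P({t_{m_N} ≤ T} ∖ lowerFailSet N) < ε₃` — **the `o(1)` bookkeeping** (choice `λ = δ^{1/2}`;
  the Brownian modulus term is handled by `tendsto_measure_badModulusSet`);
* `exists_delta_forall_coupling_lt` — consequently, for `ε₂, ε₃ > 0`, `T ≥ 0` and bounds on the
  constants there is `δ₀ > 0` such that every valid driving data with mesh `δ ≤ δ₀` and horizon
  `N` in the window `(κ+2) T + 1 ≤ N δ² ≤ (κ+2) T + 2` admits a coupling on `C × C` with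
  `ρ{∃ t ≤ T, ε₂ < dist} < ε₃ + P(lowerFailSet N)`.

## References

* G. F. Lawler, O. Schramm, W. Werner, Ann. Probab. 32 (2004), Thm. 3.7, §3.3, Thm. 4.4.
-/

noncomputable section

open MeasureTheory ProbabilityTheory Filter Set
open scoped NNReal ENNReal Topology

namespace Literature.Probability.RandomPlanarGeometry.SkorokhodEmbedding

open Literature.Probability.Process Literature.Probability.RandomPlanarGeometry

/-! ### The sup-deviation event on the product path space -/

/-- The event "the two paths are `ε`-apart at some time `≤ T`". [folklore] -/
def supDevSet (T ε : ℝ) : Set (C(ℝ≥0, ℝ) × C(ℝ≥0, ℝ)) :=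
  {p | ∃ t : ℝ≥0, (t : ℝ) ≤ T ∧ ε ≤ dist (p.1 t) (p.2 t)}

/-- The strict version of the event is contained in `supDevSet`. [folklore] -/
theorem setOf_lt_subset_supDevSet (T ε : ℝ) :
    {p : C(ℝ≥0, ℝ) × C(ℝ≥0, ℝ) | ∃ t : ℝ≥0, (t : ℝ) ≤ T ∧ ε < dist (p.1 t) (p.2 t)} ⊆ supDevSet T ε := by
  rintro p ⟨t, ht, hε⟩
  exact ⟨t, ht, hε.le⟩

/-- **`supDevSet` is closed** (compactness of `[0, T]` and locally uniform convergence).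
[folklore] -/
theorem isClosed_supDevSet (T ε : ℝ) : IsClosed (supDevSet T ε) := by
  refine IsSeqClosed.isClosed fun x y hx hlim ↦ ?_
  choose s hs hε using hx
  obtain ⟨s₀, hs₀, φ, hφ, hsφ⟩ := (isCompact_setOf_coe_le T).tendsto_subseq hs
  have hlim1 : Tendsto (fun n ↦ (x (φ n)).1) atTop (𝓝 y.1) :=
    (continuous_fst.tendsto y).comp (hlim.comp hφ.tendsto_atTop)
  have hlim2 : Tendsto (fun n ↦ (x (φ n)).2) atTop (𝓝 y.2) :=
    (continuous_snd.tendsto y).comp (hlim.comp hφ.tendsto_atTop)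
  have h1 : Tendsto (fun n ↦ (x (φ n)).1 (s (φ n))) atTop (𝓝 (y.1 s₀)) :=
    tendsto_apply_of_tendsto hlim1 (fun n ↦ hs _) hsφ
  have h2 : Tendsto (fun n ↦ (x (φ n)).2 (s (φ n))) atTop (𝓝 (y.2 s₀)) :=
    tendsto_apply_of_tendsto hlim2 (fun n ↦ hs _) hsφ
  exact ⟨s₀, hs₀, ge_of_tendsto' (h1.dist h2) fun n ↦ hε _⟩

/-- The bad-modulus set grows with the time horizon. [folklore] -/
theorem badModulusSet_mono_time {T T' δ ε : ℝ} (h : T ≤ T') :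
    (badModulusSet T δ ε : Set C(ℝ≥0, ℝ)) ⊆ badModulusSet T' δ ε := by
  rintro x ⟨s, t, hs, ht, hst, hε⟩
  exact ⟨s, t, hs.trans h, ht.trans h, hst, hε⟩

/-! ### The coupling -/

section Coupling

variable [MeasurableSpace C(ℝ≥0, ℝ)] [BorelSpace C(ℝ≥0, ℝ)]
variable {Ω Λ : Type} [Fintype Ω] [MeasurableSpace Ω] [MeasurableSingletonClass Ω]
  [DecidableEq Λ] [Countable Λ] [MeasurableSpace Λ] [MeasurableSingletonClass Λ]
  {DD : DrivingData Ω Λ} {N : ℕ}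

omit [BorelSpace C(ℝ≥0, ℝ)] [DecidableEq Λ] [Countable Λ] [MeasurableSpace Λ] [MeasurableSingletonClass Λ] in
/-- On a finite space with measurable singletons every map is measurable. [folklore] -/
theorem measurable_drv : Measurable DD.drv := fun _ _ ↦ (Set.toFinite _).measurableSet

/-- Time scaling is measurable on path space. [folklore] -/
theorem measurable_timeScale (κ : ℝ≥0) : Measurable (timeScale κ) := (continuous_timeScale κ).measurable

/-- **The truncated sup-deviation event on `Ω × C`**: the driving function of the sample `ω` and
the path are `ε`-apart at some time `t ≤ T` with `t ≤ t_{m_N}(ω)` (Thm. 4.4, arXiv p. 23: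
"`T₀ := min{T, t_k}`"). [cite: LawlerSchrammWerner2004, Thm. 4.4] -/
def DrivingData.truncDevSet (DD : DrivingData Ω Λ) (N : ℕ) (T ε : ℝ) : Set (Ω × C(ℝ≥0, ℝ)) :=
  {p | ∃ t : ℝ≥0, (t : ℝ) ≤ T ∧ t ≤ DD.tcap N p.1 ∧ ε ≤ dist (DD.drv p.1 t) (p.2 t)}

omit [DecidableEq Λ] [Countable Λ] [MeasurableSpace Λ] [MeasurableSingletonClass Λ] in
/-- `truncDevSet` is measurable: a finite union of products of a singleton with a closed set of
paths. [folklore] -/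
theorem measurableSet_truncDevSet (T ε : ℝ) : MeasurableSet (DD.truncDevSet N T ε) := by
  have hslice : ∀ ω₀ : Ω, IsClosed {b : C(ℝ≥0, ℝ) | ∃ t : ℝ≥0, (t : ℝ) ≤ T ∧ t ≤ DD.tcap N ω₀ ∧
      ε ≤ dist (DD.drv ω₀ t) (b t)} := by
    intro ω₀
    have h := (isClosed_supDevSet (min T (DD.tcap N ω₀ : ℝ)) ε).preimage
      (Continuous.prodMk_right (DD.drv ω₀) : Continuous fun b : C(ℝ≥0, ℝ) ↦ (DD.drv ω₀, b))
    convert h using 1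
    ext b
    simp only [supDevSet, mem_setOf_eq, mem_preimage, le_min_iff, NNReal.coe_le_coe, and_assoc]
  have heq : DD.truncDevSet N T ε = ⋃ ω₀ : Ω, ({ω₀} : Set Ω) ×ˢ {b : C(ℝ≥0, ℝ) | ∃ t : ℝ≥0,
      (t : ℝ) ≤ T ∧ t ≤ DD.tcap N ω₀ ∧ ε ≤ dist (DD.drv ω₀ t) (b t)} := by
    ext ⟨ω₀, b⟩
    simp only [DrivingData.truncDevSet, mem_setOf_eq, mem_iUnion, mem_prod, mem_singleton_iff]
    constructor
    · intro h
      exact ⟨ω₀, rfl, h⟩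
    · rintro ⟨ω₁, rfl, h⟩
      exact h
  rw [heq]
  exact MeasurableSet.iUnion fun ω₀ ↦ (measurableSet_singleton ω₀).prod (hslice ω₀).measurableSet

/-- **The coupling produced by a Skorokhod embedding witness**: the joint law of
`(W_X, t ↦ B(κt))` has the law of the driving function and the law of time-changed Brownian
motion as marginals, and its sup-deviation probability is bounded by the engine (including the
term `P(lowerFailSet N)`, zero for the data of §3.3).
Lawler–Schramm–Werner (2004), Thm. 3.7 / Thm. 4.4 ("there is a coupling of `γ` with Brownian
motion `B(t)` such that `P[sup{|W(t) - B(κt)| : t ≤ T} > ε] < ε`").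
[cite: LawlerSchrammWerner2004, Theorem 3.7] -/
theorem exists_coupling_le (hV : DD.IsValid N) (E : EmbeddingWitness DD.toMartingaleData N)
    {lam T ε : ℝ} (hlam : 0 < lam)
    (hN : (DD.κ + 1) * T + lam + N * DD.dZ ≤ N * (DD.δ ^ 2 - 4 * DD.C₁ * DD.δ ^ 4))
    (hsmall : 2 * DD.δ + DD.C₁ * DD.δ ^ 3 * N ≤ ε / 2) :
    ∃ ρ : Measure (C(ℝ≥0, ℝ) × C(ℝ≥0, ℝ)), IsProbabilityMeasure ρ ∧
      ρ.fst = DD.P.map DD.drv ∧ ρ.snd = wienerLawC.map (timeScale ⟨DD.κ, hV.κ_nonneg⟩) ∧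
      ρ (supDevSet T ε) ≤
        ENNReal.ofReal (N * DD.bZ ^ 2 / lam ^ 2) +
        ENNReal.ofReal (N * ((512 * C4 + 32) * DD.δ ^ 4) / lam ^ 2) +
        wienerLawC (badModulusSet (DD.κ * T + (2 * lam + N * DD.dZ + 2 * DD.κ * DD.δ ^ 2))
          (2 * lam + N * DD.dZ + 2 * DD.κ * DD.δ ^ 2) (ε / 2)) +
        DD.P (DD.lowerFailSet N) := by
  set κ' : ℝ≥0 := ⟨DD.κ, hV.κ_nonneg⟩ with hκ'
  have h1 : Measurable fun ω ↦ DD.drv (E.X ω) := measurable_drv.comp E.hX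
  have h2 : Measurable fun ω ↦ timeScale κ' (E.B ω) := (measurable_timeScale κ').comp E.hB
  refine ⟨E.Q.map fun ω ↦ (DD.drv (E.X ω), timeScale κ' (E.B ω)),
    Measure.isProbabilityMeasure_map (h1.prodMk h2).aemeasurable, ?_, ?_, ?_⟩
  · rw [Measure.fst_map_prodMk h2, show (fun ω ↦ DD.drv (E.X ω)) = DD.drv ∘ E.X from rfl,
      ← Measure.map_map measurable_drv E.hX, E.lawX]
  · rw [Measure.snd_map_prodMk h1, show (fun ω ↦ timeScale κ' (E.B ω)) = timeScale κ' ∘ E.B from rfl,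
      ← Measure.map_map (measurable_timeScale κ') E.hB, E.lawB]
  · rw [Measure.map_apply (h1.prodMk h2) (isClosed_supDevSet T ε).measurableSet]
    refine le_trans (measure_mono ?_) (E.measure_sup_drv_sub_B_ge_le hV hlam hN hsmall)
    rintro ω ⟨t, ht, hε⟩
    refine ⟨t, ht, ?_⟩
    rwa [Real.dist_eq] at hε

/-- **The coupling up to `min(T, t_{m_N})`, on `Ω × C`** (for the proof of Thm. 4.4, arXiv
p. 23): the joint law `ρ` of `(X, t ↦ B(κt))` of a Skorokhod embedding witness has marginals the
law `P` of the data and the law of time-changed Brownian motion, and `ρ(truncDevSet N T ε)` is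
bounded as in `measure_sup_drv_sub_B_ge_trunc_le` (no `lowerFailSet` term, no horizon
condition). Keeping the sample space `Ω` as the first factor lets the user read off `t_{m_N}`
and the truncation index from the sample. [cite: LawlerSchrammWerner2004, Thm. 4.4] -/
theorem exists_coupling_trunc_le (hV : DD.IsValid N) (hN1 : 1 ≤ N)
    (E : EmbeddingWitness DD.toMartingaleData N) {lam T ε : ℝ} (hlam : 0 < lam)
    (hsmall : 2 * DD.δ + DD.C₁ * DD.δ ^ 3 * N ≤ ε / 2) :
    ∃ ρ : Measure (Ω × C(ℝ≥0, ℝ)), IsProbabilityMeasure ρ ∧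
      ρ.fst = DD.P ∧ ρ.snd = wienerLawC.map (timeScale ⟨DD.κ, hV.κ_nonneg⟩) ∧
      ρ (DD.truncDevSet N T ε) ≤
        ENNReal.ofReal (N * DD.bZ ^ 2 / lam ^ 2) +
        ENNReal.ofReal (N * ((512 * C4 + 32) * DD.δ ^ 4) / lam ^ 2) +
        wienerLawC (badModulusSet (DD.κ * T + (2 * lam + N * DD.dZ + 2 * DD.κ * DD.δ ^ 2))
          (2 * lam + N * DD.dZ + 2 * DD.κ * DD.δ ^ 2) (ε / 2)) := by
  set κ' : ℝ≥0 := ⟨DD.κ, hV.κ_nonneg⟩ with hκ'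
  have h2 : Measurable fun ω ↦ timeScale κ' (E.B ω) := (measurable_timeScale κ').comp E.hB
  refine ⟨E.Q.map fun ω ↦ (E.X ω, timeScale κ' (E.B ω)),
    Measure.isProbabilityMeasure_map (E.hX.prodMk h2).aemeasurable, ?_, ?_, ?_⟩
  · rw [Measure.fst_map_prodMk h2]
    exact E.lawX
  · rw [Measure.snd_map_prodMk E.hX, show (fun ω ↦ timeScale κ' (E.B ω)) = timeScale κ' ∘ E.B from rfl,
      ← Measure.map_map (measurable_timeScale κ') E.hB, E.lawB]
  · rw [Measure.map_apply (E.hX.prodMk h2) (measurableSet_truncDevSet T ε)]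
    refine le_trans (measure_mono ?_) (E.measure_sup_drv_sub_B_ge_trunc_le hV hN1 hlam hsmall)
    rintro ω ⟨t, ht, htN, hε⟩
    refine ⟨t, ht, htN, ?_⟩
    rwa [Real.dist_eq] at hε

/-- **For `κ = 8` the second marginal is the law of `t ↦ B(8t)`** of the canonical Brownian
motion (the tree's `USTPeano.brownianTimeEight`). [cite: LawlerSchrammWerner2004, Thm. 4.4] -/
theorem wienerLawC_map_timeScale_eight :
    wienerLawC.map (timeScale 8) = Process.preWienerMeasure.map USTPeano.brownianTimeEight := by
  have h : USTPeano.brownianTimeEight = timeScale 8 ∘ brownianPathC := by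
    funext ω; ext t; rfl
  rw [h, ← Measure.map_map (measurable_timeScale 8) measurable_brownianPathC]
  rfl

end Coupling

/-! ### The `o(1)` bookkeeping -/

section Asymptotics

variable [MeasurableSpace C(ℝ≥0, ℝ)] [BorelSpace C(ℝ≥0, ℝ)]

/-- **Small Brownian modulus, uniformly**: for `ε, ε' > 0` and a horizon `Tm` there is `η₀ > 0`
with `μ_W(badModulusSet Tm η ε) < ε'` for all `η ≤ η₀` (`tendsto_measure_badModulusSet` for the
Wiener law on path space). [folklore] -/
theorem exists_eta_wienerLawC_badModulusSet_lt (Tm : ℝ) {ε ε' : ℝ} (hε : 0 < ε) (hε' : 0 < ε') :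
    ∃ η₀ > 0, ∀ η ≤ η₀, wienerLawC (badModulusSet Tm η ε) < ENNReal.ofReal ε' := by
  have h := tendsto_measure_badModulusSet (E := ℝ) wienerLawC Tm hε
  have hev : ∀ᶠ m : ℕ in atTop, wienerLawC (badModulusSet Tm (1 / ((m : ℝ) + 1)) ε) <
      ENNReal.ofReal ε' := h.eventually (gt_mem_nhds (ENNReal.ofReal_pos.2 hε'))
  obtain ⟨m, hm⟩ := hev.exists
  refine ⟨1 / ((m : ℝ) + 1), by positivity, fun η hη ↦ ?_⟩
  exact (measure_mono (badModulusSet_mono hη)).trans_lt hm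

omit [MeasurableSpace C(ℝ≥0, ℝ)] [BorelSpace C(ℝ≥0, ℝ)] in
/-- Elementary: the small quantities of the bookkeeping tend to `0` with `δ`. [folklore] -/
theorem tendsto_bookkeeping (a b c : ℝ) :
    Tendsto (fun δ : ℝ ↦ a * Real.sqrt δ + b * δ + c * δ ^ 2) (𝓝[>] 0) (𝓝 0) := by
  have h : Tendsto (fun δ : ℝ ↦ a * Real.sqrt δ + b * δ + c * δ ^ 2) (𝓝 0) (𝓝 0) := by
    have hc : Continuous fun δ : ℝ ↦ a * Real.sqrt δ + b * δ + c * δ ^ 2 := by fun_prop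
    have := hc.tendsto 0
    simpa using this
  exact h.mono_left nhdsWithin_le_nhds

/-- **The truncation-friendly coupling with `o(1)` error** (Thm. 4.4, arXiv p. 23: the
argument of §3.3 run up to `T₀ = min{T, t_k}`): for `ε₂, ε₃ > 0`, `T ≥ 0`, `κ, C₁, C₂ ≥ 0` there
is `δ₀ > 0` such that every valid driving data (any finite sample space, any label type) with
`DD.κ = κ`, `DD.C₁ ≤ C₁`, `DD.C₂ ≤ C₂`, mesh `δ ≤ δ₀` and horizon `N` in the window
`(κ+2) T + 1 ≤ N δ² ≤ (κ+2) T + 2` admits a coupling `ρ` on `Ω × C` of `P` with the law of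
`t ↦ B(κt)` such that (i) `ρ{∃ t ≤ min(T, t_{m_N}), ε₂ ≤ |W(t) - B(κt)|} < ε₃`
(`exists_coupling_trunc_le`, `λ = δ^{1/2}`, each analytic term `< ε₃/3`), and (ii)
`P({t_{m_N} ≤ T} ∖ lowerFailSet N) < ε₃` (`measure_tcap_le_diff_lowerFailSet_le`): off the event
where the lower bound `(ΔΔ)² + Δt ≥ δ²` fails before `N` — for data frozen at a truncation index,
where that index is reached before `N` — the coupling controls all of `[0, T]`.
[cite: LawlerSchrammWerner2004, Thm. 4.4] -/
theorem exists_delta_forall_coupling_trunc_lt {ε₂ ε₃ T κ C₁ C₂ : ℝ} (hε₂ : 0 < ε₂) (hε₃ : 0 < ε₃)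
    (hT : 0 ≤ T) (hκ : 0 ≤ κ) (hC₁ : 0 ≤ C₁) (hC₂ : 0 ≤ C₂) :
    ∃ δ₀ > 0, ∀ (Ω Λ : Type) [Fintype Ω] [MeasurableSpace Ω] [MeasurableSingletonClass Ω] [Nonempty Ω]
      [DecidableEq Λ] [Countable Λ] [MeasurableSpace Λ] [MeasurableSingletonClass Λ]
      (DD : DrivingData Ω Λ) (N : ℕ), DD.IsValid N → DD.κ = κ → DD.C₁ ≤ C₁ → DD.C₂ ≤ C₂ →
      DD.δ ≤ δ₀ → (κ + 2) * T + 1 ≤ N * DD.δ ^ 2 → N * DD.δ ^ 2 ≤ (κ + 2) * T + 2 →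
      (∃ ρ : Measure (Ω × C(ℝ≥0, ℝ)), IsProbabilityMeasure ρ ∧
        ρ.fst = DD.P ∧ ρ.snd = wienerLawC.map (timeScale ⟨κ, hκ⟩) ∧
        ρ (DD.truncDevSet N T ε₂) < ENNReal.ofReal ε₃) ∧
      DD.P ({ω | (DD.tcap N ω : ℝ) ≤ T} \ DD.lowerFailSet N) < ENNReal.ofReal ε₃ := by
  set cU : ℝ := (κ + 2) * T + 2 with hcU
  have hcU0 : 0 < cU := by rw [hcU]; positivity
  -- the Brownian modulus threshold
  obtain ⟨η₀, hη₀, hmod⟩ := exists_eta_wienerLawC_badModulusSet_lt (κ * T + 1) (half_pos hε₂)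
    (by positivity : 0 < ε₃ / 3)
  -- the conditions on `δ`, as eventualities at `0⁺`
  have hC4 : 0 ≤ C4 := by rw [C4]; positivity
  -- (1) first Doob term `(4+2κ)² cU δ < ε₃/3`
  have e1 : ∀ᶠ δ in 𝓝[>] (0 : ℝ), (4 + 2 * κ) ^ 2 * cU * δ < ε₃ / 3 := by
    have h := tendsto_bookkeeping 0 ((4 + 2 * κ) ^ 2 * cU) 0
    have h' := h.eventually (gt_mem_nhds (show (0 : ℝ) < ε₃ / 3 by positivity))
    filter_upwards [h'] with δ hδ
    simpa using hδ
  -- (2) second Doob term `(512 C4 + 32) cU δ < ε₃/3`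
  have e2 : ∀ᶠ δ in 𝓝[>] (0 : ℝ), (512 * C4 + 32) * cU * δ < ε₃ / 3 := by
    have h := tendsto_bookkeeping 0 ((512 * C4 + 32) * cU) 0
    have h' := h.eventually (gt_mem_nhds (show (0 : ℝ) < ε₃ / 3 by positivity))
    filter_upwards [h'] with δ hδ
    simpa using hδ
  -- (3) `hsmall`: `2δ + C₁ cU δ ≤ ε₂/2`
  have e3 : ∀ᶠ δ in 𝓝[>] (0 : ℝ), 2 * δ + C₁ * cU * δ ≤ ε₂ / 2 := by
    have h := tendsto_bookkeeping 0 (2 + C₁ * cU) 0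
    filter_upwards [h.eventually (eventually_le_nhds (show (0 : ℝ) < ε₂ / 2 by positivity))] with δ hδ
    simp only [zero_mul, zero_add, add_zero] at hδ
    linarith
  -- (4) `hN` slack and the modulus scale: `√δ + (C₂ cU + 2κ) δ + 8 C₁ cU δ² ≤ min 1 η₀ / 2`
  have e4 : ∀ᶠ δ in 𝓝[>] (0 : ℝ),
      2 * Real.sqrt δ + (C₂ * cU + 2 * κ) * δ + 8 * C₁ * cU * δ ^ 2 ≤ min 1 η₀ / 2 := by
    have h := tendsto_bookkeeping 2 (C₂ * cU + 2 * κ) (8 * C₁ * cU)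
    filter_upwards [h.eventually (eventually_le_nhds (show (0 : ℝ) < min 1 η₀ / 2 by positivity))]
      with δ hδ
    exact hδ
  -- extract `δ₀`
  obtain ⟨r, hr, hball⟩ := Metric.eventually_nhds_iff.1 (eventually_nhdsWithin_iff.1 (e1.and (e2.and (e3.and e4))))
  refine ⟨r / 2, half_pos hr, ?_⟩
  intro Ω Λ _ _ _ _ _ _ _ _ DD N hV hκD hC₁D hC₂D hδ₀ hNlo hNhi
  have hδ := hV.δ_pos
  have hδr : dist DD.δ 0 < r := by rw [Real.dist_eq, sub_zero, abs_of_pos hδ]; linarith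
  obtain ⟨c1, c2, c3, c4⟩ := hball hδr hδ
  subst hκD
  -- the numeric consequences at `δ = DD.δ`, `λ = √δ`
  set δ := DD.δ with hδdef
  set lam := Real.sqrt δ with hlamdef
  have hlam : 0 < lam := Real.sqrt_pos.2 hδ
  have hlam2 : lam ^ 2 = δ := Real.sq_sqrt hδ.le
  have hNδ3 : (N : ℝ) * δ ^ 3 ≤ cU * δ := by nlinarith
  have hNδ4 : (N : ℝ) * δ ^ 4 ≤ cU * δ ^ 2 := by nlinarith
  have hN0 : (0 : ℝ) ≤ N := Nat.cast_nonneg N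
  have hdZ : (N : ℝ) * DD.dZ ≤ C₂ * cU * δ + 4 * C₁ * cU * δ ^ 2 := by
    rw [DrivingData.dZ]
    have h1 : (N : ℝ) * (DD.C₂ * δ ^ 3) ≤ C₂ * cU * δ := by
      calc (N : ℝ) * (DD.C₂ * δ ^ 3) = DD.C₂ * (N * δ ^ 3) := by ring
        _ ≤ C₂ * (cU * δ) := mul_le_mul hC₂D hNδ3 (by positivity) hC₂
        _ = C₂ * cU * δ := by ring
    have h2 : (N : ℝ) * (4 * DD.C₁ * δ ^ 4) ≤ 4 * C₁ * cU * δ ^ 2 := by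
      calc (N : ℝ) * (4 * DD.C₁ * δ ^ 4) = 4 * DD.C₁ * (N * δ ^ 4) := by ring
        _ ≤ 4 * C₁ * (cU * δ ^ 2) :=
          mul_le_mul (by linarith) hNδ4 (by positivity) (by positivity)
        _ = 4 * C₁ * cU * δ ^ 2 := by ring
    linarith
  have hdZ0 : 0 ≤ DD.dZ := by
    rw [DrivingData.dZ]; have := hV.C₁_nonneg; have := hV.C₂_nonneg; positivity
  -- `hsmall`
  have hsmall : 2 * δ + DD.C₁ * δ ^ 3 * N ≤ ε₂ / 2 := by
    have : DD.C₁ * δ ^ 3 * N ≤ C₁ * cU * δ := by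
      calc DD.C₁ * δ ^ 3 * N = DD.C₁ * (N * δ ^ 3) := by ring
        _ ≤ C₁ * (cU * δ) := mul_le_mul hC₁D hNδ3 (by positivity) hC₁
        _ = C₁ * cU * δ := by ring
    linarith
  -- `hN`
  have hmin1 : min 1 η₀ ≤ 1 := min_le_left _ _
  have hmin2 : min 1 η₀ ≤ η₀ := min_le_right _ _
  have hsqrt0 : 0 ≤ Real.sqrt δ := Real.sqrt_nonneg δ
  have hN' : (DD.κ + 1) * T + lam + N * DD.dZ ≤ N * (δ ^ 2 - 4 * DD.C₁ * δ ^ 4) := by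
    have h4 : (N : ℝ) * (4 * DD.C₁ * δ ^ 4) ≤ 4 * C₁ * cU * δ ^ 2 := by
      calc (N : ℝ) * (4 * DD.C₁ * δ ^ 4) = 4 * DD.C₁ * (N * δ ^ 4) := by ring
        _ ≤ 4 * C₁ * (cU * δ ^ 2) :=
          mul_le_mul (by linarith) hNδ4 (by positivity) (by positivity)
        _ = 4 * C₁ * cU * δ ^ 2 := by ring
    have hκT : 0 ≤ DD.κ * T := mul_nonneg hκ hT
    nlinarith [mul_nonneg hκ hδ.le]
  -- `N ≥ 1`
  have hN1 : 1 ≤ N := by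
    rcases Nat.eq_zero_or_pos N with h0 | hpos
    · exfalso
      subst h0
      have : (0 : ℝ) ≤ (DD.κ + 2) * T := by positivity
      simp only [Nat.cast_zero, zero_mul] at hNlo
      linarith
    · exact hpos
  haveI := hV.md.prob
  -- the Skorokhod embedding
  obtain ⟨E⟩ := nonempty_embeddingWitness hV.md hδ.le N
  -- the three terms are `< ε₃ / 3`
  have t1 : (N : ℝ) * DD.bZ ^ 2 / lam ^ 2 < ε₃ / 3 := by
    rw [hlam2, DrivingData.bZ, div_lt_iff₀ hδ]
    calc (N : ℝ) * ((4 + 2 * DD.κ) * δ ^ 2) ^ 2 = (4 + 2 * DD.κ) ^ 2 * (N * δ ^ 3) * δ := by ring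
      _ ≤ (4 + 2 * DD.κ) ^ 2 * (cU * δ) * δ := by gcongr
      _ = (4 + 2 * DD.κ) ^ 2 * cU * δ * δ := by ring
      _ < ε₃ / 3 * δ := mul_lt_mul_of_pos_right c1 hδ
  have t2 : (N : ℝ) * ((512 * C4 + 32) * δ ^ 4) / lam ^ 2 < ε₃ / 3 := by
    rw [hlam2, div_lt_iff₀ hδ]
    calc (N : ℝ) * ((512 * C4 + 32) * δ ^ 4) = (512 * C4 + 32) * (N * δ ^ 3) * δ := by ring
      _ ≤ (512 * C4 + 32) * (cU * δ) * δ := by gcongr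
      _ = (512 * C4 + 32) * cU * δ * δ := by ring
      _ < ε₃ / 3 * δ := mul_lt_mul_of_pos_right c2 hδ
  have hη : 2 * lam + N * DD.dZ + 2 * DD.κ * δ ^ 2 ≤ min 1 η₀ := by
    have hc4 : 2 * lam + (C₂ * cU + 2 * DD.κ) * δ + 8 * C₁ * cU * δ ^ 2 ≤ min 1 η₀ / 2 := c4
    have hpos : 0 ≤ min 1 η₀ := le_min zero_le_one hη₀.le
    have hA : 0 ≤ (C₂ * cU + 2 * DD.κ) * δ :=
      mul_nonneg (add_nonneg (mul_nonneg hC₂ hcU0.le) (mul_nonneg zero_le_two hκ)) hδ.le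
    have hB : 0 ≤ 8 * C₁ * cU * δ ^ 2 :=
      mul_nonneg (mul_nonneg (mul_nonneg (by norm_num) hC₁) hcU0.le) (sq_nonneg δ)
    have hnn : 0 ≤ C₁ * cU * δ ^ 2 := mul_nonneg (mul_nonneg hC₁ hcU0.le) (sq_nonneg δ)
    have hlam1 : lam ≤ 1 := by linarith
    have hδ1 : δ ≤ 1 := by rw [← hlam2]; exact pow_le_one₀ hlam.le hlam1
    have hexp : (C₂ * cU + 2 * DD.κ) * δ = C₂ * cU * δ + 2 * DD.κ * δ := by ring
    have hδsq : δ ^ 2 ≤ δ := by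
      have := pow_le_pow_of_le_one hδ.le hδ1 (show 1 ≤ 2 by norm_num)
      rwa [pow_one] at this
    have hexp2 : 2 * DD.κ * δ ^ 2 ≤ 2 * DD.κ * δ :=
      mul_le_mul_of_nonneg_left hδsq (mul_nonneg zero_le_two hκ)
    linarith
  have hTm : DD.κ * T + (2 * lam + N * DD.dZ + 2 * DD.κ * δ ^ 2) ≤ DD.κ * T + 1 :=
    add_le_add le_rfl (hη.trans hmin1)
  have t3 : wienerLawC (badModulusSet (DD.κ * T + (2 * lam + N * DD.dZ + 2 * DD.κ * δ ^ 2))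
      (2 * lam + N * DD.dZ + 2 * DD.κ * δ ^ 2) (ε₂ / 2)) < ENNReal.ofReal (ε₃ / 3) :=
    lt_of_le_of_lt (measure_mono ((badModulusSet_mono_time hTm).trans
      (badModulusSet_mono (hη.trans hmin2)))) (hmod η₀ le_rfl)
  refine ⟨?_, ?_⟩
  · obtain ⟨ρ, hρ, hfst, hsnd, hbound⟩ := exists_coupling_trunc_le hV hN1 E (T := T) hlam hsmall
    refine ⟨ρ, hρ, hfst, by rw [hsnd], hbound.trans_lt ?_⟩
    calc ENNReal.ofReal (N * DD.bZ ^ 2 / lam ^ 2) +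
          ENNReal.ofReal (N * ((512 * C4 + 32) * δ ^ 4) / lam ^ 2) +
          wienerLawC (badModulusSet (DD.κ * T + (2 * lam + N * DD.dZ + 2 * DD.κ * δ ^ 2))
            (2 * lam + N * DD.dZ + 2 * DD.κ * δ ^ 2) (ε₂ / 2))
        < ENNReal.ofReal (ε₃ / 3) + ENNReal.ofReal (ε₃ / 3) + ENNReal.ofReal (ε₃ / 3) := by
          refine ENNReal.add_lt_add (ENNReal.add_lt_add ?_ ?_) t3
          · exact (ENNReal.ofReal_lt_ofReal_iff (by positivity)).2 t1
          · exact (ENNReal.ofReal_lt_ofReal_iff (by positivity)).2 t2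
      _ = ENNReal.ofReal ε₃ := by
          rw [← ENNReal.ofReal_add (by positivity) (by positivity),
            ← ENNReal.ofReal_add (by positivity) (by positivity)]
          congr 1; ring
  · calc DD.P ({ω | (DD.tcap N ω : ℝ) ≤ T} \ DD.lowerFailSet N)
        ≤ ENNReal.ofReal (N * DD.bZ ^ 2 / lam ^ 2) :=
          DrivingData.measure_tcap_le_diff_lowerFailSet_le hV hlam hN'
      _ < ENNReal.ofReal (ε₃ / 3) := (ENNReal.ofReal_lt_ofReal_iff (by positivity)).2 t1
      _ ≤ ENNReal.ofReal ε₃ := ENNReal.ofReal_le_ofReal (by linarith)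

/-- **The driving-function coupling with `o(1)` error** — Lawler–Schramm–Werner (2004),
Thm. 3.7 / Thm. 4.4 in their stated form, for abstract driving data: for `ε₂, ε₃ > 0`, `T ≥ 0`,
a diffusivity `κ ≥ 0` and bounds `C₁, C₂ ≥ 0` on the constants there is `δ₀ > 0` such that for
every finite sample space and label type and every driving data on them with `DD.κ = κ`, `DD.C₁ ≤ C₁`, `DD.C₂ ≤ C₂`, mesh `0 < DD.δ ≤ δ₀`, valid up
to a horizon `N` in the window `(κ+2) T + 1 ≤ N δ² ≤ (κ+2) T + 2` (LSW: `N = ⌈10 T δ⁻²⌉`), there is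
a coupling `ρ` of the law of the driving function with the law of `t ↦ B(κt)` with
`ρ{∃ t ≤ T, ε₂ < dist} < ε₃ + P(lowerFailSet N)` (the Skorokhod embedding exists by
`nonempty_embeddingWitness`; `λ = δ^{1/2}`; the three analytic terms of the engine are each
`< ε₃/3` for `δ` small; the last term vanishes for the data of §3.3 and is the truncation error
otherwise).
[cite: LawlerSchrammWerner2004, Theorem 3.7] -/
theorem exists_delta_forall_coupling_lt {ε₂ ε₃ T κ C₁ C₂ : ℝ} (hε₂ : 0 < ε₂) (hε₃ : 0 < ε₃)
    (hT : 0 ≤ T) (hκ : 0 ≤ κ) (hC₁ : 0 ≤ C₁) (hC₂ : 0 ≤ C₂) :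
    ∃ δ₀ > 0, ∀ (Ω Λ : Type) [Fintype Ω] [MeasurableSpace Ω] [MeasurableSingletonClass Ω] [Nonempty Ω]
      [DecidableEq Λ] [Countable Λ] [MeasurableSpace Λ] [MeasurableSingletonClass Λ]
      (DD : DrivingData Ω Λ) (N : ℕ), DD.IsValid N → DD.κ = κ → DD.C₁ ≤ C₁ → DD.C₂ ≤ C₂ →
      DD.δ ≤ δ₀ → (κ + 2) * T + 1 ≤ N * DD.δ ^ 2 → N * DD.δ ^ 2 ≤ (κ + 2) * T + 2 →
      ∃ ρ : Measure (C(ℝ≥0, ℝ) × C(ℝ≥0, ℝ)), IsProbabilityMeasure ρ ∧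
        ρ.fst = DD.P.map DD.drv ∧ ρ.snd = wienerLawC.map (timeScale ⟨κ, hκ⟩) ∧
        ρ {p | ∃ t : ℝ≥0, (t : ℝ) ≤ T ∧ ε₂ < dist (p.1 t) (p.2 t)} <
          ENNReal.ofReal ε₃ + DD.P (DD.lowerFailSet N) := by
  obtain ⟨δ₀, hδ₀, h⟩ := exists_delta_forall_coupling_trunc_lt hε₂ (half_pos hε₃) hT hκ hC₁ hC₂
  refine ⟨δ₀, hδ₀, ?_⟩
  intro Ω Λ _ _ _ _ _ _ _ _ DD N hV hκD hC₁D hC₂D hδ₀' hNlo hNhi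
  obtain ⟨⟨ρ, hρ, hfst, hsnd, hlt⟩, hP⟩ := h Ω Λ DD N hV hκD hC₁D hC₂D hδ₀' hNlo hNhi
  haveI := hV.md.prob
  have hm1 : Measurable fun p : Ω × C(ℝ≥0, ℝ) ↦ DD.drv p.1 := measurable_drv.comp measurable_fst
  have hm : Measurable fun p : Ω × C(ℝ≥0, ℝ) ↦ (DD.drv p.1, p.2) := hm1.prodMk measurable_snd
  refine ⟨ρ.map fun p ↦ (DD.drv p.1, p.2), Measure.isProbabilityMeasure_map hm.aemeasurable,
    ?_, ?_, ?_⟩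
  · rw [Measure.fst_map_prodMk measurable_snd, ← hfst,
      show (fun p : Ω × C(ℝ≥0, ℝ) ↦ DD.drv p.1) = DD.drv ∘ Prod.fst from rfl,
      ← Measure.map_map measurable_drv measurable_fst]
    rfl
  · rw [Measure.snd_map_prodMk hm1, ← hsnd]
    rfl
  · -- split the event according to `t ≤ t_{m_N}` or `t_{m_N} < t ≤ T`
    calc (ρ.map fun p ↦ (DD.drv p.1, p.2)) {p | ∃ t : ℝ≥0, (t : ℝ) ≤ T ∧ ε₂ < dist (p.1 t) (p.2 t)}
        ≤ (ρ.map fun p ↦ (DD.drv p.1, p.2)) (supDevSet T ε₂) :=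
          measure_mono (setOf_lt_subset_supDevSet T ε₂)
      _ = ρ ((fun p ↦ (DD.drv p.1, p.2)) ⁻¹' supDevSet T ε₂) :=
          Measure.map_apply hm (isClosed_supDevSet T ε₂).measurableSet
      _ ≤ ρ (DD.truncDevSet N T ε₂ ∪ Prod.fst ⁻¹' {ω | (DD.tcap N ω : ℝ) ≤ T}) := by
          refine measure_mono ?_
          rintro ⟨ω, b⟩ ⟨t, ht, hε⟩
          by_cases htN : t ≤ DD.tcap N ω
          · exact Or.inl ⟨t, ht, htN, hε⟩
          · right
            have h' : (DD.tcap N ω : ℝ) ≤ t := by exact_mod_cast (not_le.1 htN).le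
            exact h'.trans ht
      _ ≤ ρ (DD.truncDevSet N T ε₂) + ρ (Prod.fst ⁻¹' {ω | (DD.tcap N ω : ℝ) ≤ T}) :=
          measure_union_le _ _
      _ = ρ (DD.truncDevSet N T ε₂) + DD.P {ω | (DD.tcap N ω : ℝ) ≤ T} := by
          rw [← Measure.fst_apply (Set.toFinite _).measurableSet, hfst]
      _ ≤ ρ (DD.truncDevSet N T ε₂) + (DD.P ({ω | (DD.tcap N ω : ℝ) ≤ T} \ DD.lowerFailSet N) +
            DD.P (DD.lowerFailSet N)) := by
          refine add_le_add le_rfl ?_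
          calc DD.P {ω | (DD.tcap N ω : ℝ) ≤ T}
              ≤ DD.P (({ω | (DD.tcap N ω : ℝ) ≤ T} \ DD.lowerFailSet N) ∪ DD.lowerFailSet N) := by
                refine measure_mono fun ω hω ↦ ?_
                by_cases h : ω ∈ DD.lowerFailSet N
                exacts [Or.inr h, Or.inl ⟨hω, h⟩]
            _ ≤ _ := measure_union_le _ _
      _ < ENNReal.ofReal (ε₃ / 2) + (ENNReal.ofReal (ε₃ / 2) + DD.P (DD.lowerFailSet N)) :=
          ENNReal.add_lt_add hlt (ENNReal.add_lt_add_right (measure_ne_top _ _) hP)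
      _ = ENNReal.ofReal ε₃ + DD.P (DD.lowerFailSet N) := by
          rw [← add_assoc, ← ENNReal.ofReal_add (by positivity) (by positivity), add_halves]

end Asymptotics

/-! ### No truncation before `T` when the path stays small: the first case of the proof of Thm. 4.4

Lawler–Schramm–Werner (2004), proof of Thm. 4.4 (arXiv Thm. 23, p. 23), first case: "Let us
first assume that `φ(0)` is close to `i` … and that `T` is small enough so that `T ≤ 1/100` and
`P[B[0, T] ⊂ [-1/10, 1/10]] > 1 - ε₃/3` … Let `k` be the first integer where `rad₀(D_k) ≤ r₀`
or `ℌ_{D_k}(0, α_k) ∉ [ε, 1 - ε]` and define `T₀ := min{T, t_k}` … we may couple `W` with a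
Brownian motion `B` in such a way that `P[sup{|W(t) - B(8t)| : t ∈ [0, T₀]} > ε₂/3] < ε₃/3`
… By our assumptions regarding `T`, we have with high probability that for all `t ∈ [0, T₀]`,
`W(t) ∈ [-1/5, 1/5]`. If we choose `r₁` large enough, this guarantees that" `T₀ = T` with high
probability. Abstractly: the data carry a truncation capacity `tstar ω` (`= t_k`) with
(H1) `lowerFailSet N ⊆ {tstar ≤ t_{m_N}}` (the lower bound of the stopping indices fails only
from the truncation index on) and (H2) the GEOMETRIC implication "`|W| < 2r` on
`[0, min(T, tstar)]` forces `T < tstar`" (LSW: `r = 1/10`; from Koebe's theorem, the diameter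
bounds of Lemma 2.1 and the choice of `r₁` — the lattice/conformal side, not proved here); then
the deviation over ALL of `[0, T]` is controlled by the two truncated events, the event
`{sup_{t ≤ T} |B(κt)| ≥ r}` and `{t_{m_N} ≤ T} ∖ lowerFailSet N`. -/

section NoTruncation

variable [MeasurableSpace C(ℝ≥0, ℝ)] [BorelSpace C(ℝ≥0, ℝ)]

/-- Paths reaching absolute value `r` at some time `≤ T` (complement of LSW's event
"`B[0, T] ⊂ [-1/10, 1/10]`"). [cite: LawlerSchrammWerner2004, Thm. 4.4] -/
def supAbsSet (T r : ℝ) : Set C(ℝ≥0, ℝ) := {b | ∃ t : ℝ≥0, (t : ℝ) ≤ T ∧ r ≤ |b t|}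

omit [MeasurableSpace C(ℝ≥0, ℝ)] [BorelSpace C(ℝ≥0, ℝ)] in
/-- `supAbsSet` is closed (a slice of `supDevSet` at the zero path). [folklore] -/
theorem isClosed_supAbsSet (T r : ℝ) : IsClosed (supAbsSet T r) := by
  have h := (isClosed_supDevSet T r).preimage (Continuous.prodMk_right (0 : C(ℝ≥0, ℝ)))
  convert h using 1
  ext b
  simp [supAbsSet, supDevSet, Real.dist_eq]

omit [MeasurableSpace C(ℝ≥0, ℝ)] [BorelSpace C(ℝ≥0, ℝ)] in
/-- `supAbsSet` is antitone in the level. [folklore] -/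
theorem supAbsSet_anti {T r r' : ℝ} (h : r ≤ r') : supAbsSet T r' ⊆ supAbsSet T r := by
  rintro b ⟨t, ht, hr⟩
  exact ⟨t, ht, h.trans hr⟩

/-- **`sup_{t ≤ T} |B(κt)| < r` with high probability for `T` small** ("`T` is small enough so
that … `P[B[0, T] ⊂ [-1/10, 1/10]] > 1 - ε₃/3`"): for `r, ε > 0` there is `T₁ > 0` with
`(μ_W ∘ timeScale κ⁻¹)(supAbsSet T₁ r) < ε` (paths start at `0`; modulus of continuity of the
time-changed Wiener law, `tendsto_measure_badModulusSet`). [cite: LawlerSchrammWerner2004, Thm. 4.4] -/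
theorem exists_pos_map_timeScale_supAbsSet_lt (κ : ℝ≥0) {r ε : ℝ} (hr : 0 < r) (hε : 0 < ε) :
    ∃ T₁ > 0, wienerLawC.map (timeScale κ) (supAbsSet T₁ r) < ENNReal.ofReal ε := by
  set μ := wienerLawC.map (timeScale κ) with hμ
  haveI : IsProbabilityMeasure μ :=
    Measure.isProbabilityMeasure_map (measurable_timeScale κ).aemeasurable
  have h := tendsto_measure_badModulusSet (E := ℝ) μ 1 hr
  obtain ⟨m, hm⟩ := (h.eventually (gt_mem_nhds (ENNReal.ofReal_pos.2 hε))).exists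
  set T₁ : ℝ := min 1 (1 / ((m : ℝ) + 1)) with hT₁
  refine ⟨T₁, by positivity, lt_of_le_of_lt ?_ hm⟩
  have hT1 : T₁ ≤ 1 := min_le_left _ _
  have hTm : T₁ ≤ 1 / ((m : ℝ) + 1) := min_le_right _ _
  -- `μ (supAbsSet T₁ r) ≤ μ (badModulusSet 1 T₁ r)` through the paths starting at `0`
  rw [hμ, Measure.map_apply (measurable_timeScale κ) (isClosed_supAbsSet _ _).measurableSet,
    Measure.map_apply (measurable_timeScale κ) (isClosed_badModulusSet _ _ _).measurableSet]
  have hnull : wienerLawC {p : C(ℝ≥0, ℝ) | ¬ p 0 = 0} = 0 := ae_iff.1 ae_apply_zero_eq_zero_wienerLawC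
  have hsub : (timeScale κ) ⁻¹' supAbsSet T₁ r ⊆
      (timeScale κ) ⁻¹' badModulusSet 1 (1 / ((m : ℝ) + 1)) r ∪ {p : C(ℝ≥0, ℝ) | ¬ p 0 = 0} := by
    intro p hp
    by_cases h0 : p 0 = 0
    · left
      obtain ⟨t, ht, hrt⟩ := hp
      refine ⟨0, t, by simp, ht.trans hT1, ?_, ?_⟩
      · rw [NNReal.dist_eq, NNReal.coe_zero, zero_sub, abs_neg, abs_of_nonneg t.coe_nonneg]
        exact ht.trans hTm
      · simp only [timeScale_apply, mul_zero, h0, Real.dist_eq, zero_sub, abs_neg]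
        simpa using hrt
    · exact Or.inr h0
  calc wienerLawC ((timeScale κ) ⁻¹' supAbsSet T₁ r)
      ≤ wienerLawC ((timeScale κ) ⁻¹' badModulusSet 1 (1 / ((m : ℝ) + 1)) r ∪ {p | ¬ p 0 = 0}) :=
        measure_mono hsub
    _ ≤ wienerLawC ((timeScale κ) ⁻¹' badModulusSet 1 (1 / ((m : ℝ) + 1)) r) +
        wienerLawC {p : C(ℝ≥0, ℝ) | ¬ p 0 = 0} := measure_union_le _ _
    _ = _ := by rw [hnull, add_zero]

variable {Ω Λ : Type} [Fintype Ω] [MeasurableSpace Ω] [MeasurableSingletonClass Ω]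
  [DecidableEq Λ] [Countable Λ] [MeasurableSpace Λ] [MeasurableSingletonClass Λ]
  {DD : DrivingData Ω Λ} {N : ℕ}

omit [MeasurableSpace C(ℝ≥0, ℝ)] [BorelSpace C(ℝ≥0, ℝ)] [Fintype Ω] [MeasurableSingletonClass Ω]
  [DecidableEq Λ] [Countable Λ] [MeasurableSpace Λ] [MeasurableSingletonClass Λ] in
/-- **The deterministic core of the first case of the proof of Thm. 4.4**: for a sample `ω` with
truncation capacity `tstar ω` satisfying (H1) and (H2), a path `b`, and `(ω, b)` outside the
truncated deviation events at levels `ε` and `r`, `b` outside `supAbsSet T r` and `ω` outside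
`{t_{m_N} ≤ T} ∖ lowerFailSet N`, the deviation is `< ε` on ALL of `[0, T]`: if `t_{m_N} ≤ T`
then `ω ∈ lowerFailSet N`, so `tstar ω ≤ t_{m_N} ≤ T` by (H1); but `|W| ≤ |W - b| + |b| < 2r`
on `[0, min(T, tstar)]`, so `T < tstar ω` by (H2) — a contradiction ("this guarantees that
`T₀ = T`"). [cite: LawlerSchrammWerner2004, Thm. 4.4] -/
theorem DrivingData.dist_drv_lt_of_trunc {T ε r : ℝ} (tstar : Ω → ℝ) {ω : Ω} {b : C(ℝ≥0, ℝ)}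
    (hH1 : ω ∈ DD.lowerFailSet N → tstar ω ≤ DD.tcap N ω)
    (hH2 : (∀ t : ℝ≥0, (t : ℝ) ≤ T → (t : ℝ) ≤ tstar ω → |DD.drv ω t| < 2 * r) → T < tstar ω)
    (h1 : (ω, b) ∉ DD.truncDevSet N T ε) (h2 : (ω, b) ∉ DD.truncDevSet N T r)
    (h3 : b ∉ supAbsSet T r) (h4 : ω ∉ {ω | (DD.tcap N ω : ℝ) ≤ T} \ DD.lowerFailSet N)
    {t : ℝ≥0} (ht : (t : ℝ) ≤ T) : dist (DD.drv ω t) (b t) < ε := by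
  simp only [DrivingData.truncDevSet, mem_setOf_eq, not_exists, not_and, not_le] at h1 h2
  simp only [supAbsSet, mem_setOf_eq, not_exists, not_and, not_le] at h3
  by_cases hTN : T < (DD.tcap N ω : ℝ)
  · exact h1 t ht (by exact_mod_cast (ht.trans_lt hTN).le)
  · exfalso
    rw [not_lt] at hTN
    have hlow : ω ∈ DD.lowerFailSet N := by
      by_contra h
      exact h4 ⟨hTN, h⟩
    have hstar : tstar ω ≤ DD.tcap N ω := hH1 hlow
    have hsmallW : ∀ u : ℝ≥0, (u : ℝ) ≤ T → (u : ℝ) ≤ tstar ω → |DD.drv ω u| < 2 * r := by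
      intro u hu hu'
      have huN : u ≤ DD.tcap N ω := by exact_mod_cast hu'.trans hstar
      have d1 := h2 u hu huN
      have d2 := h3 u hu
      rw [Real.dist_eq] at d1
      calc |DD.drv ω u| = |(DD.drv ω u - b u) + b u| := by rw [sub_add_cancel]
        _ ≤ |DD.drv ω u - b u| + |b u| := abs_add_le _ _
        _ < r + r := add_lt_add d1 d2
        _ = 2 * r := by ring
    have := hH2 hsmallW
    linarith

omit [DecidableEq Λ] [Countable Λ] [MeasurableSpace Λ] [MeasurableSingletonClass Λ] in
/-- **The union bound of the first case of the proof of Thm. 4.4**: for any measure `ρ` on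
`Ω × C` and truncation capacities satisfying (H1), (H2),
`ρ{∃ t ≤ T, ε ≤ |W - b|} ≤ ρ(truncDevSet N T ε) + ρ(truncDevSet N T r) + ρ.snd(supAbsSet T r)
  + ρ.fst({t_{m_N} ≤ T} ∖ lowerFailSet N)`. [cite: LawlerSchrammWerner2004, Thm. 4.4] -/
theorem measure_supDev_le_of_trunc (ρ : Measure (Ω × C(ℝ≥0, ℝ))) {T ε r : ℝ} (tstar : Ω → ℝ)
    (hH1 : ∀ ω, ω ∈ DD.lowerFailSet N → tstar ω ≤ DD.tcap N ω)
    (hH2 : ∀ ω, (∀ t : ℝ≥0, (t : ℝ) ≤ T → (t : ℝ) ≤ tstar ω → |DD.drv ω t| < 2 * r) →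
      T < tstar ω) :
    ρ {p | ∃ t : ℝ≥0, (t : ℝ) ≤ T ∧ ε ≤ dist (DD.drv p.1 t) (p.2 t)} ≤
      ρ (DD.truncDevSet N T ε) + ρ (DD.truncDevSet N T r) + ρ.snd (supAbsSet T r) +
        ρ.fst ({ω | (DD.tcap N ω : ℝ) ≤ T} \ DD.lowerFailSet N) := by
  have hcover : {p : Ω × C(ℝ≥0, ℝ) | ∃ t : ℝ≥0, (t : ℝ) ≤ T ∧ ε ≤ dist (DD.drv p.1 t) (p.2 t)} ⊆
      DD.truncDevSet N T ε ∪ DD.truncDevSet N T r ∪ Prod.snd ⁻¹' supAbsSet T r ∪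
        Prod.fst ⁻¹' ({ω | (DD.tcap N ω : ℝ) ≤ T} \ DD.lowerFailSet N) := by
    rintro ⟨ω, b⟩ ⟨t, ht, hε⟩
    by_contra hnot
    simp only [mem_union, not_or, mem_preimage] at hnot
    obtain ⟨⟨⟨h1, h2⟩, h3⟩, h4⟩ := hnot
    have := DrivingData.dist_drv_lt_of_trunc tstar (hH1 ω) (hH2 ω) h1 h2 h3 h4 ht
    linarith
  calc ρ {p | ∃ t : ℝ≥0, (t : ℝ) ≤ T ∧ ε ≤ dist (DD.drv p.1 t) (p.2 t)}
      ≤ ρ (DD.truncDevSet N T ε ∪ DD.truncDevSet N T r ∪ Prod.snd ⁻¹' supAbsSet T r ∪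
          Prod.fst ⁻¹' ({ω | (DD.tcap N ω : ℝ) ≤ T} \ DD.lowerFailSet N)) := measure_mono hcover
    _ ≤ ρ (DD.truncDevSet N T ε ∪ DD.truncDevSet N T r ∪ Prod.snd ⁻¹' supAbsSet T r) +
          ρ (Prod.fst ⁻¹' ({ω | (DD.tcap N ω : ℝ) ≤ T} \ DD.lowerFailSet N)) := measure_union_le _ _
    _ ≤ ρ (DD.truncDevSet N T ε ∪ DD.truncDevSet N T r) + ρ (Prod.snd ⁻¹' supAbsSet T r) +
          ρ (Prod.fst ⁻¹' ({ω | (DD.tcap N ω : ℝ) ≤ T} \ DD.lowerFailSet N)) :=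
        add_le_add (measure_union_le _ _) le_rfl
    _ ≤ ρ (DD.truncDevSet N T ε) + ρ (DD.truncDevSet N T r) + ρ (Prod.snd ⁻¹' supAbsSet T r) +
          ρ (Prod.fst ⁻¹' ({ω | (DD.tcap N ω : ℝ) ≤ T} \ DD.lowerFailSet N)) :=
        add_le_add (add_le_add (measure_union_le _ _) le_rfl) le_rfl
    _ = _ := by
        rw [Measure.snd_apply (isClosed_supAbsSet T r).measurableSet,
          Measure.fst_apply (Set.toFinite _).measurableSet]

omit [MeasurableSpace C(ℝ≥0, ℝ)] [BorelSpace C(ℝ≥0, ℝ)] [Fintype Ω] [MeasurableSingletonClass Ω]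
  [DecidableEq Λ] [Countable Λ] [MeasurableSpace Λ] [MeasurableSingletonClass Λ] in
/-- `truncDevSet` is antitone in the level. [folklore] -/
theorem DrivingData.truncDevSet_anti {T ε ε' : ℝ} (h : ε ≤ ε') :
    DD.truncDevSet N T ε' ⊆ DD.truncDevSet N T ε := by
  rintro p ⟨t, ht, htN, hε⟩
  exact ⟨t, ht, htN, h.trans hε⟩

/-- **The first case of the proof of Thm. 4.4, abstractly** (arXiv p. 23): for `ε₂, ε₃ > 0`,
`r > 0`, `κ, C₁, C₂ ≥ 0` and a horizon `T ≥ 0` small enough that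
`P{sup_{t ≤ T} |B(κt)| ≥ r} < ε₃/4` (`exists_pos_map_timeScale_supAbsSet_lt`), there is `δ₀ > 0`
such that every valid driving data with `DD.κ = κ`, `DD.C₁ ≤ C₁`, `DD.C₂ ≤ C₂`, mesh `δ ≤ δ₀`,
horizon `N` in the window `(κ+2) T + 1 ≤ N δ² ≤ (κ+2) T + 2`, and truncation capacities `tstar`
satisfying (H1) `ω ∈ lowerFailSet N → tstar ω ≤ t_{m_N}(ω)` and (H2)
`(|W_ω| < 2r on [0, min(T, tstar ω)]) → T < tstar ω`, admits a coupling `ρ` on `C × C` of the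
law of the driving function with the law of `t ↦ B(κt)` with
`ρ{∃ t ≤ T, ε₂ < |W(t) - B(κt)|} < ε₃` — the conclusion of Thm. 4.4 / Thm. 3.7 over the whole
interval `[0, T]` (`exists_delta_forall_coupling_trunc_lt` at level `min ε₂ r` and error `ε₃/4`,
`measure_supDev_le_of_trunc`). [cite: LawlerSchrammWerner2004, Thm. 4.4] -/
theorem exists_delta_forall_coupling_lt_of_trunc {ε₂ ε₃ T κ C₁ C₂ r : ℝ} (hε₂ : 0 < ε₂)
    (hε₃ : 0 < ε₃) (hT : 0 ≤ T) (hκ : 0 ≤ κ) (hC₁ : 0 ≤ C₁) (hC₂ : 0 ≤ C₂) (hr : 0 < r)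
    (hBr : wienerLawC.map (timeScale ⟨κ, hκ⟩) (supAbsSet T r) < ENNReal.ofReal (ε₃ / 4)) :
    ∃ δ₀ > 0, ∀ (Ω Λ : Type) [Fintype Ω] [MeasurableSpace Ω] [MeasurableSingletonClass Ω] [Nonempty Ω]
      [DecidableEq Λ] [Countable Λ] [MeasurableSpace Λ] [MeasurableSingletonClass Λ]
      (DD : DrivingData Ω Λ) (N : ℕ) (tstar : Ω → ℝ), DD.IsValid N → DD.κ = κ → DD.C₁ ≤ C₁ →
      DD.C₂ ≤ C₂ → DD.δ ≤ δ₀ → (κ + 2) * T + 1 ≤ N * DD.δ ^ 2 → N * DD.δ ^ 2 ≤ (κ + 2) * T + 2 →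
      (∀ ω, ω ∈ DD.lowerFailSet N → tstar ω ≤ DD.tcap N ω) →
      (∀ ω, (∀ t : ℝ≥0, (t : ℝ) ≤ T → (t : ℝ) ≤ tstar ω → |DD.drv ω t| < 2 * r) → T < tstar ω) →
      ∃ ρ : Measure (C(ℝ≥0, ℝ) × C(ℝ≥0, ℝ)), IsProbabilityMeasure ρ ∧
        ρ.fst = DD.P.map DD.drv ∧ ρ.snd = wienerLawC.map (timeScale ⟨κ, hκ⟩) ∧
        ρ {p | ∃ t : ℝ≥0, (t : ℝ) ≤ T ∧ ε₂ < dist (p.1 t) (p.2 t)} < ENNReal.ofReal ε₃ := by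
  obtain ⟨δ₀, hδ₀, h⟩ := exists_delta_forall_coupling_trunc_lt (lt_min hε₂ hr)
    (by positivity : 0 < ε₃ / 4) hT hκ hC₁ hC₂
  refine ⟨δ₀, hδ₀, ?_⟩
  intro Ω Λ _ _ _ _ _ _ _ _ DD N tstar hV hκD hC₁D hC₂D hδ hNlo hNhi hH1 hH2
  obtain ⟨⟨ρ, hρ, hfst, hsnd, hlt⟩, hP⟩ := h Ω Λ DD N hV hκD hC₁D hC₂D hδ hNlo hNhi
  haveI := hV.md.prob
  have hm1 : Measurable fun p : Ω × C(ℝ≥0, ℝ) ↦ DD.drv p.1 := measurable_drv.comp measurable_fst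
  have hm : Measurable fun p : Ω × C(ℝ≥0, ℝ) ↦ (DD.drv p.1, p.2) := hm1.prodMk measurable_snd
  refine ⟨ρ.map fun p ↦ (DD.drv p.1, p.2), Measure.isProbabilityMeasure_map hm.aemeasurable,
    ?_, ?_, ?_⟩
  · rw [Measure.fst_map_prodMk measurable_snd, ← hfst,
      show (fun p : Ω × C(ℝ≥0, ℝ) ↦ DD.drv p.1) = DD.drv ∘ Prod.fst from rfl,
      ← Measure.map_map measurable_drv measurable_fst]
    rfl
  · rw [Measure.snd_map_prodMk hm1, ← hsnd]
    rfl
  · have e1 : ρ (DD.truncDevSet N T ε₂) < ENNReal.ofReal (ε₃ / 4) :=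
      lt_of_le_of_lt (measure_mono (DrivingData.truncDevSet_anti (min_le_left ε₂ r))) hlt
    have e2 : ρ (DD.truncDevSet N T r) < ENNReal.ofReal (ε₃ / 4) :=
      lt_of_le_of_lt (measure_mono (DrivingData.truncDevSet_anti (min_le_right ε₂ r))) hlt
    have e3 : ρ.snd (supAbsSet T r) < ENNReal.ofReal (ε₃ / 4) := by rwa [hsnd]
    have e4 : ρ.fst ({ω | (DD.tcap N ω : ℝ) ≤ T} \ DD.lowerFailSet N) < ENNReal.ofReal (ε₃ / 4) := by
      rwa [hfst]
    calc (ρ.map fun p ↦ (DD.drv p.1, p.2)) {p | ∃ t : ℝ≥0, (t : ℝ) ≤ T ∧ ε₂ < dist (p.1 t) (p.2 t)}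
        ≤ (ρ.map fun p ↦ (DD.drv p.1, p.2)) (supDevSet T ε₂) :=
          measure_mono (setOf_lt_subset_supDevSet T ε₂)
      _ = ρ ((fun p ↦ (DD.drv p.1, p.2)) ⁻¹' supDevSet T ε₂) :=
          Measure.map_apply hm (isClosed_supDevSet T ε₂).measurableSet
      _ = ρ {p | ∃ t : ℝ≥0, (t : ℝ) ≤ T ∧ ε₂ ≤ dist (DD.drv p.1 t) (p.2 t)} := rfl
      _ ≤ ρ (DD.truncDevSet N T ε₂) + ρ (DD.truncDevSet N T r) + ρ.snd (supAbsSet T r) +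
            ρ.fst ({ω | (DD.tcap N ω : ℝ) ≤ T} \ DD.lowerFailSet N) :=
          measure_supDev_le_of_trunc ρ tstar hH1 hH2
      _ < ENNReal.ofReal (ε₃ / 4) + ENNReal.ofReal (ε₃ / 4) + ENNReal.ofReal (ε₃ / 4) +
            ENNReal.ofReal (ε₃ / 4) :=
          ENNReal.add_lt_add (ENNReal.add_lt_add (ENNReal.add_lt_add e1 e2) e3) e4
      _ = ENNReal.ofReal ε₃ := by
          rw [← ENNReal.ofReal_add (by positivity) (by positivity),
            ← ENNReal.ofReal_add (by positivity) (by positivity),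
            ← ENNReal.ofReal_add (by positivity) (by positivity)]
          congr 1; ring

end NoTruncation

end Literature.Probability.RandomPlanarGeometry.SkorokhodEmbedding

end

/-!
# [LSW04] Thm. 4.4 reduced to the discrete key estimate

Topic `Probability/RandomPlanarGeometry`. Everything here is PROVED; no named fact is introduced.

Lawler–Schramm–Werner (2004), proof of Thm. 4.4 (arXiv version math/0112234, p. 23): "The proof
is almost identical to the proof of Theorem 3.7, where we used Skorokhod's embedding, but one has
to be a little careful because it may happen that `0` is 'swallowed' before time `T`. […] Exactly
as in the proof of Theorem 3.7, Proposition 4.2 implies that we may couple `W` with a Brownian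
motion `B` in such a way that `P[sup{|W(t) - B(8t)| : t ∈ [0, T₀]} > ε₂/3] < ε₃/3`."
The §3.3 argument is formalized abstractly above (Skorokhod embedding, two Doob maximal
inequalities, Brownian modulus) above. This part performs the last, formal step: **the named fact
`USTPeano.drivingProcess_tendsto` ([LSW04] Thm. 4.4 in the form used for Thm. 4.7) follows from
the discrete-side input alone**, namely from the existence, along any sequence of grid
approximations, of `DrivingData` with law `ustLaw`, driving function `W`, `κ = 8`, bounded
constants, mesh `δₙ → 0`, valid up to horizons `Nₙ` with `Nₙ δₙ² ∈ [10 T + 1, 10 T + 2]`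
(`theorem drivingProcess_tendsto_of_drivingData`). What remains for Thm. 4.4 is therefore the
discrete side: [LSW04] Prop. 4.2 (the hitting-probability "key estimate" for the UST Peano curve)
in the form `DrivingData.IsValid` up to a horizon `N` with `N δ² ≥ 10 T + 1` — including LSW's
"little care" about the swallowing of `0` (arXiv p. 23), which concerns the range of validity of
Prop. 4.2 and hence the construction of such data, not the engine.

## References

* G. F. Lawler, O. Schramm, W. Werner, Ann. Probab. 32 (2004), Thm. 3.7, §3.3, Thm. 4.4 (arXiv
  version math/0112234, pp. 14–15 and p. 23).
-/

noncomputable section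

open MeasureTheory ProbabilityTheory Filter Set
open UpperHalfPlane (upperHalfPlaneSet)
open scoped NNReal ENNReal Topology

namespace Literature.Probability.RandomPlanarGeometry

open scoped PathBorel

namespace USTPeano

open SkorokhodEmbedding

/-- **[LSW04] Thm. 4.4 from the discrete key estimate.** Suppose that for every smooth domain,
every sequence of grid approximations `Δₙ` at scales `Rₙ → ∞` with Peano paths, every choice of
normalised maps / capacity images / driving functions `Wₙ`, and every `T ≥ 0`, there are a label
type `Λ`, constants `C₁, C₂ ≥ 0`, driving data `DDₙ` on the Peano paths of `Δₙ` with
`DDₙ.P = ustLaw Δₙ`, `DDₙ.drv = Wₙ`, `κ = 8`, `DDₙ.C₁ ≤ C₁`, `DDₙ.C₂ ≤ C₂`, meshes `δₙ → 0`, and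
horizons `Nₙ` such that the probability of `lowerFailSet` (failure of `(ΔΔ)² + Δt ≥ δ²` before
`Nₙ`; zero for untruncated data) tends to `0`, and eventually `DDₙ` is valid up to `Nₙ` and
`10 T + 1 ≤ Nₙ δₙ² ≤ 10 T + 2` (this is [LSW04] Prop. 4.2 with the choice `N = ⌈10 T δ⁻²⌉` of
§3.3, arXiv pp. 14–15, p. 23). Then the driving process of the UST Peano curve converges to
`B(8t)`: `drivingProcess_tendsto` holds (via `exists_delta_forall_coupling_lt` and
`drivingProcess_tendsto_of_coupling`). [cite: LawlerSchrammWerner2004, Thm. 4.4] -/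
theorem drivingProcess_tendsto_of_drivingData
    (hkey : ∀ (D : SmoothDomain) (R : ℕ → ℝ) (Δ : ℕ → Domain), Tendsto R atTop atTop →
      (∀ n, IsApproximation D (R n) (Δ n)) → (∀ n, Nonempty (PeanoPath (Δ n))) →
        ∀ (φ : ∀ n, ConformalEquiv upperHalfPlaneSet (Δ n).carrier)
          (Γ : ∀ n, PeanoPath (Δ n) → C(ℝ≥0, ℂ)) (W : ∀ n, PeanoPath (Δ n) → C(ℝ≥0, ℝ)),
          (∀ n, (Δ n).IsLSWMap (φ n) ∧ ∀ γ, IsCapacityImage (Δ n) (φ n) γ (Γ n γ) (W n γ)) →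
            ∀ T : ℝ, 0 ≤ T →
              ∃ (Λ : Type) (_ : DecidableEq Λ) (_ : MeasurableSpace Λ) (_ : Countable Λ)
                (_ : MeasurableSingletonClass Λ) (C₁ C₂ : ℝ)
                (DD : ∀ n, DrivingData (PeanoPath (Δ n)) Λ) (N : ℕ → ℕ),
                0 ≤ C₁ ∧ 0 ≤ C₂ ∧
                (∀ n, (DD n).P = ustLaw (Δ n) ∧ (DD n).drv = W n ∧ (DD n).κ = 8 ∧
                  (DD n).C₁ ≤ C₁ ∧ (DD n).C₂ ≤ C₂) ∧
                Tendsto (fun n ↦ (DD n).δ) atTop (𝓝 0) ∧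
                Tendsto (fun n ↦ (DD n).P ((DD n).lowerFailSet (N n))) atTop (𝓝 0) ∧
                ∀ᶠ n in atTop, (DD n).IsValid (N n) ∧
                  10 * T + 1 ≤ N n * (DD n).δ ^ 2 ∧ N n * (DD n).δ ^ 2 ≤ 10 * T + 2) :
    drivingProcess_tendsto := by
  refine drivingProcess_tendsto_of_coupling fun D R Δ hR hΔ hne φ Γ W hΓW T ε₂ ε₃ hε₂ hε₃ ↦ ?_
  -- work with the nonnegative horizon `max T 0`
  obtain ⟨Λ, _, _, _, _, C₁, C₂, DD, N, hC₁, hC₂, hdata, hδ, hlow, hval⟩ :=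
    hkey D R Δ hR hΔ hne φ Γ W hΓW (max T 0) (le_max_right _ _)
  obtain ⟨δ₀, hδ₀, hcoup⟩ := exists_delta_forall_coupling_lt hε₂ (half_pos hε₃) (le_max_right T 0)
    (by norm_num : (0 : ℝ) ≤ 8) hC₁ hC₂
  have hlow' : ∀ᶠ n in atTop, (DD n).P ((DD n).lowerFailSet (N n)) < ENNReal.ofReal (ε₃ / 2) :=
    hlow.eventually (gt_mem_nhds (ENNReal.ofReal_pos.2 (half_pos hε₃)))
  filter_upwards [hδ.eventually (eventually_le_nhds hδ₀), hval, hlow'] with n hδn hvn hln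
  haveI := hne n
  obtain ⟨hP, hdrv, hκ, hC₁n, hC₂n⟩ := hdata n
  obtain ⟨ρ, -, hfst, hsnd, hlt⟩ := hcoup (PeanoPath (Δ n)) Λ (DD n) (N n) hvn.1 hκ hC₁n hC₂n hδn
    (by linarith [hvn.2.1]) (by linarith [hvn.2.2])
  refine ⟨ρ, ?_, ?_, ?_⟩
  · rw [hfst, hP, hdrv]
  · rw [hsnd, show (⟨(8 : ℝ), (by norm_num : (0 : ℝ) ≤ 8)⟩ : ℝ≥0) = 8 from by ext; rfl]
    exact wienerLawC_map_timeScale_eight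
  · refine lt_of_le_of_lt (measure_mono ?_) (hlt.trans_le ?_)
    · rintro p ⟨t, ht, hε⟩
      exact ⟨t, ht.trans (le_max_left _ _), hε⟩
    · calc ENNReal.ofReal (ε₃ / 2) + (DD n).P ((DD n).lowerFailSet (N n))
          ≤ ENNReal.ofReal (ε₃ / 2) + ENNReal.ofReal (ε₃ / 2) := add_le_add le_rfl hln.le
        _ = ENNReal.ofReal ε₃ := by
          rw [← ENNReal.ofReal_add (by positivity) (by positivity)]; congr 1; ring

end USTPeano

end Literature.Probability.RandomPlanarGeometry

end

/-!
# Driving data from the raw key estimate: compensating the driving increments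

Topic `Probability/RandomPlanarGeometry`, sub-namespace `SkorokhodEmbedding`. Everything here is
PROVED; no named fact is introduced.

Lawler–Schramm–Werner (2004), §3.3 (arXiv version math/0112234, p. 14): given the key estimate
along the stopping indices, "For `n ≤ N`, set
`M_n := ∑_{j=0}^{n-1} (Δ_{m_{j+1}} - Δ_{m_j} - E[Δ_{m_{j+1}} - Δ_{m_j} | 𝓕_j])`. Clearly, `M_0, …, M_N`
is a martingale for `𝓕_0, …, 𝓕_N`. The definition of `m_n` and the choice of `r₁` imply that
`‖M_{n+1} - M_n‖_∞ ≤ 2δ`." This last part performs this step once and for all: from **raw driving data**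
(finite probability space, histories, adapted capacities / driving values / driving function, and
the *raw* atomwise estimates `|E[ΔΔ | 𝓕_k]| ≤ C₁ δ³`,
`|E[(ΔΔ)² - κ Δt | 𝓕_k]| ≤ C₂ δ³`, `|ΔΔ| ≤ 2δ - C₁ δ³`) it builds `DrivingData` whose martingale is
the compensated driving sequence (`MartingaleData.comp`, file `CompensatedMartingale`) and proves
`DrivingData.IsValid` (`RawDrivingData.isValid_toDrivingData`), and it restates the reduction of
[LSW04] Thm. 4.4 (`drivingProcess_tendsto_of_drivingData`) with raw data as input
(`drivingProcess_tendsto_of_rawDrivingData`).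

## References

* G. F. Lawler, O. Schramm, W. Werner, Ann. Probab. 32 (2004), §3.3, Thm. 4.4 (arXiv version
  pp. 14–15, 22–23).
-/

noncomputable section

open MeasureTheory ProbabilityTheory Filter Set
open UpperHalfPlane (upperHalfPlaneSet)
open scoped NNReal ENNReal Topology

namespace Literature.Probability.RandomPlanarGeometry.SkorokhodEmbedding

/-! ### Raw driving data -/

/-- **Raw driving data**: a finite probability space with histories `H k`, mesh `δ`, capacities
`tcap k = t_{m_k}`, driving values `dval k = Δ_{m_k}`, the driving function `drv` of the sample, the
diffusivity `κ` and the constants `C₁, C₂` of the key estimate — the input of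
Lawler–Schramm–Werner (2004), §3.3 *before* the martingale `M` is formed.
[cite: LawlerSchrammWerner2004, Theorem 3.7] -/
structure RawDrivingData (Ω Λ : Type) [MeasurableSpace Ω] where
  /-- the probability law of the finite sample space -/
  P : Measure Ω
  /-- the history up to the stopping index `m_k` -/
  H : ℕ → Ω → Λ
  /-- the mesh -/
  δ : ℝ
  /-- the capacities `t_{m_k}` -/
  tcap : ℕ → Ω → ℝ≥0
  /-- the driving values `Δ_{m_k}` -/
  dval : ℕ → Ω → ℝ
  /-- the driving function of the sample -/
  drv : Ω → C(ℝ≥0, ℝ)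
  /-- the diffusivity -/
  κ : ℝ
  /-- the constant of `|E[ΔΔ | 𝓕]| ≤ C₁ δ³` -/
  C₁ : ℝ
  /-- the constant of `|E[(ΔΔ)² - κ Δt | 𝓕]| ≤ C₂ δ³` -/
  C₂ : ℝ

namespace RawDrivingData

variable {Ω Λ : Type} [Fintype Ω] [MeasurableSpace Ω] [DecidableEq Λ] (R : RawDrivingData Ω Λ)

/-- The underlying filtered space as martingale data with the zero martingale (only `P`, `H`, `δ`
are used: atoms, conditional means, compensators). [folklore] -/
def base : MartingaleData Ω Λ := ⟨R.P, R.H, fun _ _ ↦ 0, R.δ⟩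

/-- **The compensated driving sequence** `M_n = Δ_{m_n} - ∑_{j<n} E[Δ_{m_{j+1}} - Δ_{m_j} | 𝓕_j]`.
[cite: LawlerSchrammWerner2004, Theorem 3.7] -/
def M : ℕ → Ω → ℝ := R.base.comp R.dval

/-- **The driving data of raw driving data**: martingale `M` = the compensated driving sequence.
[cite: LawlerSchrammWerner2004, Theorem 3.7] -/
def toDrivingData : DrivingData Ω Λ where
  P := R.P
  H := R.H
  M := R.M
  δ := R.δ
  tcap := R.tcap
  dval := R.dval
  drv := R.drv
  κ := R.κ
  C₁ := R.C₁
  C₂ := R.C₂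

/-- **The raw hypotheses** up to the horizon `N`: probability space, refining histories, `δ > 0`,
nonnegative constants, adapted capacities and driving values starting at `0`, capacities
nondecreasing with increments `≤ 2δ²`, driving increments `≤ 2δ - C₁ δ³` (LSW: "`|Δ_{m_{n+1}} -
Δ_{m_n}|` is `δ` plus one lattice step", so that `‖ΔM‖_∞ ≤ 2δ`), the two raw atomwise key
estimates `|E[ΔΔ | 𝓕_k]| ≤ C₁ δ³` and `|E[(ΔΔ)² - κ Δt | 𝓕_k]| ≤ C₂ δ³` (Lawler–Schramm–Werner
(2004), Prop. 3.4 / Prop. 4.2 along the stopping indices, §3.3), and the link of the driving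
function with the driving values (`W(t_{m_k}) = Δ_{m_k}`, `2δ`-oscillation in between). The
increment bound and the first-moment bound are required at all indices (freeze the data after
the horizon). [cite: LawlerSchrammWerner2004, Theorem 3.7] -/
structure IsValid (N : ℕ) : Prop where
  prob : IsProbabilityMeasure R.P
  refine : ∀ ⦃k n : ℕ⦄ ⦃ω ω' : Ω⦄, k ≤ n → R.H n ω = R.H n ω' → R.H k ω = R.H k ω'
  δ_pos : 0 < R.δ
  κ_nonneg : 0 ≤ R.κ
  C₁_nonneg : 0 ≤ R.C₁
  C₂_nonneg : 0 ≤ R.C₂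
  t_adapt : ∀ k ω ω', R.H k ω = R.H k ω' → R.tcap k ω = R.tcap k ω'
  d_adapt : ∀ k ω ω', R.H k ω = R.H k ω' → R.dval k ω = R.dval k ω'
  t_zero : ∀ ω, R.tcap 0 ω = 0
  d_zero : ∀ ω, R.dval 0 ω = 0
  t_mono : ∀ k ω, R.tcap k ω ≤ R.tcap (k + 1) ω
  t_inc : ∀ k < N, ∀ ω, (R.tcap (k + 1) ω : ℝ) - R.tcap k ω ≤ 2 * R.δ ^ 2
  d_inc : ∀ k ω, |R.dval (k + 1) ω - R.dval k ω| ≤ 2 * R.δ - R.C₁ * R.δ ^ 3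
  mean : ∀ k l, |R.base.condMean k (fun ω ↦ R.dval (k + 1) ω - R.dval k ω) l| ≤ R.C₁ * R.δ ^ 3
  key : ∀ k < N, ∀ l, |R.base.condMean k (fun ω ↦ (R.dval (k + 1) ω - R.dval k ω) ^ 2 -
    R.κ * ((R.tcap (k + 1) ω : ℝ) - R.tcap k ω)) l| ≤ R.C₂ * R.δ ^ 3
  drv_at : ∀ k ≤ N, ∀ ω, R.drv ω (R.tcap k ω) = R.dval k ω
  drv_osc : ∀ k < N, ∀ ω, ∀ s : ℝ≥0, R.tcap k ω ≤ s → s ≤ R.tcap (k + 1) ω →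
    |R.drv ω s - R.dval k ω| ≤ 2 * R.δ

variable {R} {N : ℕ}

/-- The zero martingale data of the base are valid. [folklore] -/
theorem isValid_base (hR : R.IsValid N) : R.base.IsValid where
  prob := hR.prob
  refine := hR.refine
  adapted := fun _ _ _ _ ↦ rfl
  zero := fun _ ↦ rfl
  martingale := fun n l ↦ by simp [base]
  bdd := fun n ω ↦ by
    change |(0 : ℝ) - 0| ≤ 2 * R.δ
    rw [sub_zero, abs_zero]; linarith [hR.δ_pos]

/-- The driving values are adapted. [folklore] -/
theorem isAdaptedSeq_dval (hR : R.IsValid N) : R.base.IsAdaptedSeq R.dval :=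
  fun k ω ω' h ↦ hR.d_adapt k ω ω' h

/-- The increment of the compensated driving sequence. [folklore] -/
theorem M_succ_sub (k : ℕ) (ω : Ω) :
    R.M (k + 1) ω - R.M k ω = (R.dval (k + 1) ω - R.dval k ω) - R.base.drift R.dval k ω :=
  MartingaleData.comp_succ_sub (D := R.base) R.dval k ω

/-- **The compensator is `O(δ³)`**: `|E[Δ_{m_{k+1}} - Δ_{m_k} | 𝓕_k]| ≤ C₁ δ³` at every sample.
[cite: LawlerSchrammWerner2004, Theorem 3.7] -/
theorem abs_drift_le (hR : R.IsValid N) (k : ℕ) (ω : Ω) : |R.base.drift R.dval k ω| ≤ R.C₁ * R.δ ^ 3 :=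
  hR.mean k (R.H k ω)

/-- **The driving data built from valid raw data are valid**: `M` is a martingale adapted to the
histories with `M 0 = 0` and `‖ΔM‖_∞ ≤ 2δ` ("Clearly, `M_0, …, M_N` is a martingale … `‖M_{n+1} -
M_n‖_∞ ≤ 2δ`"), `|ΔM - ΔΔ| = |E[ΔΔ | 𝓕]| ≤ C₁ δ³`, and the remaining hypotheses are carried over.
[cite: LawlerSchrammWerner2004, Theorem 3.7] -/
theorem isValid_toDrivingData (hR : R.IsValid N) : R.toDrivingData.IsValid N where
  md :=
    { prob := hR.prob
      refine := hR.refine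
      adapted := fun n ω ω' h ↦
        MartingaleData.comp_factor (D := R.base) (isValid_base hR) (isAdaptedSeq_dval hR) n h
      zero := fun ω ↦ by
        change R.base.comp R.dval 0 ω = 0
        rw [MartingaleData.comp_zero, hR.d_zero ω]
      martingale := fun n l ↦ MartingaleData.sum_atom_mul_comp_succ_sub (D := R.base) R.dval n l
      bdd := fun n ω ↦ by
        change |R.M (n + 1) ω - R.M n ω| ≤ 2 * R.δ
        rw [M_succ_sub]
        have h1 := hR.d_inc n ω
        have h2 := abs_drift_le hR n ω
        calc |R.dval (n + 1) ω - R.dval n ω - R.base.drift R.dval n ω|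
            ≤ |R.dval (n + 1) ω - R.dval n ω| + |R.base.drift R.dval n ω| := abs_sub _ _
          _ ≤ 2 * R.δ - R.C₁ * R.δ ^ 3 + R.C₁ * R.δ ^ 3 := add_le_add h1 h2
          _ = 2 * R.δ := by ring }
  δ_pos := hR.δ_pos
  κ_nonneg := hR.κ_nonneg
  C₁_nonneg := hR.C₁_nonneg
  C₂_nonneg := hR.C₂_nonneg
  t_adapt := hR.t_adapt
  d_adapt := hR.d_adapt
  t_zero := hR.t_zero
  d_zero := hR.d_zero
  t_mono := hR.t_mono
  t_inc := hR.t_inc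
  d_inc := fun k _ ω ↦ (hR.d_inc k ω).trans (by
    change 2 * R.δ - R.C₁ * R.δ ^ 3 ≤ 2 * R.δ
    linarith [mul_nonneg hR.C₁_nonneg (pow_nonneg hR.δ_pos.le 3)])
  M_sub_d := fun k _ ω ↦ by
    change |R.M (k + 1) ω - R.M k ω - (R.dval (k + 1) ω - R.dval k ω)| ≤ R.C₁ * R.δ ^ 3
    rw [M_succ_sub, sub_sub_cancel_left, abs_neg]
    exact abs_drift_le hR k ω
  key := hR.key
  drv_at := hR.drv_at
  drv_osc := hR.drv_osc

/-- The law, driving function, diffusivity and constants of the built data (definitional).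
[folklore] -/
theorem toDrivingData_P : R.toDrivingData.P = R.P := rfl

/-- See `toDrivingData_P`. [folklore] -/
theorem toDrivingData_drv : R.toDrivingData.drv = R.drv := rfl

/-- See `toDrivingData_P`. [folklore] -/
theorem toDrivingData_δ : R.toDrivingData.δ = R.δ := rfl

/-- The failure event of the lower bound, for the built data (definitional). [folklore] -/
theorem toDrivingData_lowerFailSet (N : ℕ) :
    R.toDrivingData.lowerFailSet N =
      {ω | ∃ k < N, (R.dval (k + 1) ω - R.dval k ω) ^ 2 + ((R.tcap (k + 1) ω : ℝ) - R.tcap k ω) <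
        R.δ ^ 2} := rfl

end RawDrivingData

end SkorokhodEmbedding

/-! ### [LSW04] Thm. 4.4 from raw driving data -/

open scoped PathBorel

namespace USTPeano

open SkorokhodEmbedding

/-- **[LSW04] Thm. 4.4 from the raw discrete key estimate**: as
`drivingProcess_tendsto_of_drivingData`, with *raw* driving data (histories, capacities, driving
values, driving function and the raw atomwise key estimates of Prop. 4.2 along the stopping
indices; the compensated martingale is formed here) in place of `DrivingData`.
[cite: LawlerSchrammWerner2004, Thm. 4.4] -/
theorem drivingProcess_tendsto_of_rawDrivingData
    (hkey : ∀ (D : SmoothDomain) (R : ℕ → ℝ) (Δ : ℕ → Domain), Tendsto R atTop atTop →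
      (∀ n, IsApproximation D (R n) (Δ n)) → (∀ n, Nonempty (PeanoPath (Δ n))) →
        ∀ (φ : ∀ n, ConformalEquiv upperHalfPlaneSet (Δ n).carrier)
          (Γ : ∀ n, PeanoPath (Δ n) → C(ℝ≥0, ℂ)) (W : ∀ n, PeanoPath (Δ n) → C(ℝ≥0, ℝ)),
          (∀ n, (Δ n).IsLSWMap (φ n) ∧ ∀ γ, IsCapacityImage (Δ n) (φ n) γ (Γ n γ) (W n γ)) →
            ∀ T : ℝ, 0 ≤ T →
              ∃ (Λ : Type) (_ : DecidableEq Λ) (_ : MeasurableSpace Λ) (_ : Countable Λ)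
                (_ : MeasurableSingletonClass Λ) (C₁ C₂ : ℝ)
                (RD : ∀ n, RawDrivingData (PeanoPath (Δ n)) Λ) (N : ℕ → ℕ),
                0 ≤ C₁ ∧ 0 ≤ C₂ ∧
                (∀ n, (RD n).P = ustLaw (Δ n) ∧ (RD n).drv = W n ∧ (RD n).κ = 8 ∧
                  (RD n).C₁ ≤ C₁ ∧ (RD n).C₂ ≤ C₂) ∧
                Tendsto (fun n ↦ (RD n).δ) atTop (𝓝 0) ∧
                Tendsto (fun n ↦ (RD n).P {ω | ∃ k < N n,
                  ((RD n).dval (k + 1) ω - (RD n).dval k ω) ^ 2 +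
                    (((RD n).tcap (k + 1) ω : ℝ) - (RD n).tcap k ω) < (RD n).δ ^ 2}) atTop (𝓝 0) ∧
                ∀ᶠ n in atTop, (RD n).IsValid (N n) ∧
                  10 * T + 1 ≤ N n * (RD n).δ ^ 2 ∧ N n * (RD n).δ ^ 2 ≤ 10 * T + 2) :
    drivingProcess_tendsto := by
  refine drivingProcess_tendsto_of_drivingData fun D R Δ hR hΔ hne φ Γ W hΓW T hT ↦ ?_
  obtain ⟨Λ, i1, i2, i3, i4, C₁, C₂, RD, N, hC₁, hC₂, hdata, hδ, hlow, hval⟩ :=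
    hkey D R Δ hR hΔ hne φ Γ W hΓW T hT
  refine ⟨Λ, i1, i2, i3, i4, C₁, C₂, fun n ↦ (RD n).toDrivingData, N, hC₁, hC₂,
    fun n ↦ hdata n, hδ, hlow, ?_⟩
  filter_upwards [hval] with n hn
  exact ⟨RawDrivingData.isValid_toDrivingData hn.1, hn.2⟩

end USTPeano

end Literature.Probability.RandomPlanarGeometry

end
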